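import Literature.MathematicalPhysics.QuantumFieldTheory.Balaban1983to89.B2Ineq258HiggsRegion
import Literature.MathematicalPhysics.QuantumFieldTheory.Balaban1983to89.B2Eq230CondShiftBound
import Literature.MathematicalPhysics.QuantumFieldTheory.Balaban1983to89.B2Eq2108ErrorBound
import Literature.MathematicalPhysics.QuantumFieldTheory.Balaban1983to89.B2Eq28RegionsBigBlockUnion

/-!
# `Balaban1983to89.B2Eq267HiggsRegion` — [Balaban1982Higgs2] Lemma 2.4, printed proof step **(2.67)** p. 572 ON THE
# (Higgs)₂,₃ CARRIER OF RECORD: the localization of the background scalar field `φ^{(k)}` (2.56) to a neighbourhood `□`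
# of the block `B^k(y)`, «Using Proposition 2.2 and the restrictions (2.55)» — i.e. from the four (2.58) clauses for
# regions of own gens 16–17 (`B2Ineq258HiggsRegion`, over p35's (I.2.25)/(I.2.26)-for-regions theorems)

statement-level skeleton of published theorems with citation tags; proofs where landed; nothing here is a claim
about the Yang–Mills mass gap

PDF held: `paper:balaban1982-cmp86-higgs23-ii` (journal page = PDF page + 554); p. 572 [PDF 18] read on the text layer
`p0018.txt` and the ×2 render `run/shared/lean/pub/pub-balaban/b2b-balaban-ref1/pages/1982-cmp86-higgs23-II/1982-cmp86-higgs23-II-p018-x2.png`;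
pp. 570–571 [PDF 16–17] for (2.55)/(2.56)/(2.58).

CITATION HEADER (lean-in-tree rule).  T. Bałaban, *(Higgs)₂,₃ quantum fields in a finite volume. II. An upper bound*,
Commun. Math. Phys. **86** (1982) 555–594, doi:10.1007/bf01214890 [Balaban1982Higgs2].  Cell `lit-balaban` (HOME
`run/shared/lean/pub/lit-balaban/`), Phase-2 proof seat **p23** gen 17 (unit `lit-balaban-p23-g17`; TAKING #2 line
HOME/STATUS.md 2026-08-22T15:3xZ; v1 = p332428 ACCEPTED 3b2137c47989; v1.1 (same gen) APPEND-ONLY §6, §§1–5 verbatim; v1.2 (gen 20) DOC-ONLY: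
`prime_mono`'s locator «(3.47) p.588» → «(3.22) p.588», summit-lit1 CITELOC P84-001); SKELETON row **B2.Lem2.4** (Lemma 2.4 (2.65)–(2.66) p. 572; owner r02, second reader
r14; decl of record `B2.Lemma24Printed`, head `proved p250408 · …` by referee ruling — a MODEL-FAMILY theorem of own gen 5 on
the b04 box lineage, UNCHANGED; this file is a cells-only member: the printed step (2.67) for the carrier of record's own
objects).  USED BY NAME, never restated: the typer's concrete (2.56) `B2Eq255Concrete.bgScalar256` (with `cutTo`,
`underRegion`), own `B2Ineq258HiggsRegion.ineq258_GQ_higgs_region_inside` (v1, p329192) and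
`ineq258_dGQ_higgs_region_inside` / `exp_joint_le` (v1.2, p331766) — the (2.58) value clause and `δG_k`-clause for regions
on the carrier at a regular field (over p35's p328271 / p330931) — and their `D^η_A`-companions `ineq258_DGQ_higgs_region_inside`
(v1.1, p329698) / `ineq258_DdGQ_higgs_region_inside` (v1.2) (over p35's p329161 / p330931), p35's `covDeriv_sum'`/`covDeriv_sub'`,
own g14 `B2Ineq258HiggsTorus.exp_blockDist_le`, the
typer's lattice sum `B2Eq230CondShiftBound.sum_exp_neg_tdist_le` (`Σ_y e^{−δ|x−y|} ≤ K_d(δ)` = `B4Sect5Proof.latticeConst`),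
r14's `B2StepK.rDecayBeatsPowers_of_printed` («e^{−δ₁r(Lᵏε)} beats every power»), own gen-7
`B2Eq2108ErrorBound.printedThreshold_le` (the (2.55)₄ threshold is polynomial in `(Lᵏε)⁻¹`).

WHAT IS PRINTED (p. 572 [PDF 18], the sentences as printed).  *"Lemma 2.4. Under the restrictions (2.55) we have
φ^{(k)}(x) = U(A^{(k)}(Γ^{(k)}_{x,y}))φ(y) + O(p(Lᵏε)) = (Q_k^*(A^{(k)})φ)(x) + O(p(Lᵏε)), for x ∈ Bᵏ(y), y ∈ Λ₇^{(k−1)′}, (2.65)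
(D^η_{A^{(k)}}φ^{(k)})(b) = O(p(Lᵏε)) for b ⊂ Bᵏ(Λ₇^{(k−1)′}). (2.66)  Let us define □₁, □₂ as the sums of large blocks
contained in Λ₇^{(k−1)′} and distant from the point y less than 2r(Lᵏε), 4r(Lᵏε) respectively, and let us denote □ = Bᵏ(□₂).
Of course □ ⊂ Bᵏ(Λ₂^{(k−1)′}). Using Proposition 2.2 and the restrictions (2.55) we get
φ^{(k)}(x) = (a_kG_k(□, A^{(k)})Q_k^*(A^{(k)})□₁φ)(x) + O((Lᵏε)^κ), x ∈ Bᵏ(y), (2.67) and the same equality for the covariant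
derivative of φ^{(k)}."*  With (2.56) p. 570: *"φ^{(k)} = a_kG_k(Bᵏ(Λ₂^{(k−1)′}), A^{(k)})Q_k^*(A^{(k)})Λ₆^{(k−1)′}φ"* and
(2.55)₄ p. 570: *"|φ(x)| ≤ c₁λ(L^{k−1}ε)^{−1/4}p(L^{k−1}ε) for x ∈ Λ₋₁^{(k−1)′}"*.

THE ARGUMENT (ours, spelled out; print says only «Using Proposition 2.2 and the restrictions (2.55)»).  Write
`Ω = Bᵏ(Λ₂′)`, `□ = Bᵏ(□₂)`, `□₁ ⊆ □₂ ∩ Λ₆′`.  By linearity `Q_k^*(A)Λ₆′φ = Σ_{y′∈Λ₆′} Q_k^*(A)(φ(y′)δ_{y′})`, so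
`φ^{(k)}(x) − (a_kG_k(□,A)Q_k^*(A)□₁φ)(x) = a_k(Lᵏε)^{−2}·[Σ_{y′∈□₁}((G^ε_k(Ω,A) − G^ε_k(□,A))Q_k^*(A)(φ(y′)δ_{y′}))(x)
 + Σ_{y′∈Λ₆′∖□₁}(G^ε_k(Ω,A)Q_k^*(A)(φ(y′)δ_{y′}))(x)]`.  The first sum is the `δG_k(□, Ω, A)`-clause of (2.58) (own v1.2
`ineq258_dGQ_higgs_region_inside`, block `Bᵏ(y′) ⊂ □`): each term is `≤ c₀(Lᵏε)²e^{δ₀}e^{−δ₀|x_k − y′|}e^{−δ₀dist(x,□ᶜ)/Lᵏ}|φ(y′)|`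
(`δ₀ = 1/(4K₀)`, the third distance `dist(Bᵏ(y′), □ᶜ) ≥ 0` dropped); the second is the value clause (own v1
`ineq258_GQ_higgs_region_inside` on `Ω`): each term `≤ c₀(Lᵏε)²e^{2δ₀}e^{−2δ₀|x_k − y′|}|φ(y′)| ≤ c₀(Lᵏε)²e^{2δ₀}e^{−δ₀ρ}e^{−δ₀|x_k−y′|}|φ(y′)|`
when `|x_k − y′| ≥ ρ` off `□₁`.  Summing `Σ_{y′}e^{−δ₀|x_k − y′|} ≤ K_d(δ₀)` (typer) gives the MAIN ESTIMATE
`‖φ^{(k)}(x) − (a_kG_k(□,A)Q_k^*(A)□₁φ)(x)‖ ≤ a_k·sup_{Λ₆′}|φ|·[C₁e^{−δ₀dist(x,□ᶜ)/Lᵏ} + C₂e^{−δ₀ρ}]` (`eq267_higgs_region`), and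
with print's radii (`dist(x, □ᶜ) ≥ (2r(Lᵏε) − s)Lᵏ`, `ρ = 2r(Lᵏε) − s` — `□₂ ⊇` the blocks within `4r` of `y`, `□₁ =` those within
`2r`, `x ∈ Bᵏ(y)`, `s` absorbing block diameters) and the (2.55)₄ threshold, r14's «decay beats powers» gives the PRINTED
`O((Lᵏε)^κ)` (`eq267_higgs_region_printed`).

WHAT THIS FILE PROVES (kernel-checked, zero `sorry`; theorems only — no definition, no `Prop` fact; axioms standard).
 §1 `cutTo_eq_sum` (`Λφ = Σ_{y∈Λ}φ(y)δ_y`), `bgScalar256_apply_eq_sum` ((2.56) at a point as a sum over source blocks);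
 §2 `norm_sum_sub_sum_le` (the two-sum bookkeeping, [folklore]); `exp_tail_le` (`e^{−2δ₀τ} ≤ e^{−δ₀ρ}e^{−δ₀τ}` for `τ ≥ ρ`);
 §3 **`eq267_higgs_region`** — THE MAIN ESTIMATE above, for `d ≥ 1`, `L ≥ 2`, `a, m² > 0`, `N`, charge data, mesh cap `ε₀`,
    regularity pair `(c, β)`: `∃ K₀min ∀ K₀ ≥ K₀min ∃ e₁ > 0 ∃ C₁ C₂ ≥ 0` such that on every torus of the carrier with `K₀ ∣ M`,
    at every level `1 ≤ k ≤ K_P` (`3LᵏK₀ ≤ |T_ε|_μ`, `Lᵏε ≤ ε₀`), for all `Λ₆′ ⊆ Λ₂′`, `□₁ ⊆ □₂ ⊆ Λ₂′`, `□₁ ⊆ Λ₆′` with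
    `Bᵏ(Λ₂′)` and `□ = Bᵏ(□₂)` big-block unions, every `A` with `0 < e_k ≤ e₁` (I.2.23)-regular on `Bᵏ(Λ₂′)`, every `x` with
    `{|z − x| ≤ 2r_S + 2LᵏK₀(d+1) + 1} ⊂ □`, every `φ` with `|φ| ≤ t` on `Λ₆′` and every `ρ ≤ min_{y′∈Λ₆′∖□₁}|x_k − y′|`;
 §4 **`eq267_higgs_region_printed`** — the printed `O((Lᵏε)^κ)`: under (2.55)₄ with the printed `p(·)`, `λ(·)`, `r(·)`
    (`B2.Params.Printed`) and the radii hypotheses `(2r(Lᵏε) − s)Lᵏ ≤ dist(x, □ᶜ)`, `2r(Lᵏε) − s ≤ |x_k − y′|` off `□₁`,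
    for every `κ`: `‖φ^{(k)}(x) − (a_kG_k(□,A)Q_k^*(A)□₁φ)(x)‖ ≤ C′·a_k·(Lᵏε)^κ`;
 §5 «and the same equality for the covariant derivative of φ^{(k)}»: `covDeriv_smul'`, `bgScalar256_eq_sum`,
    `covDeriv_bgScalar256_eq_sum`, **`eq267_deriv_higgs_region`** (the `D^ε_A`-form of the main estimate, one mesh power
    `(Lᵏε)^{−1}` less, from the `D^η_A`-clauses `ineq258_DGQ_higgs_region_inside` (v1.1) / `ineq258_DdGQ_higgs_region_inside`
    (v1.2) of (2.58) for regions) and **`eq267_deriv_higgs_region_printed`** (`≤ C′·a_k·(Lᵏε)^κ`, every `κ`);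
 §6 (v1.1) PRINT'S OWN REGIONS: the four theorems of §§3–5 instantiated at `Λ₂′ := Λ₂^{(k−1)′}`, `Λ₆′ := Λ₆^{(k−1)′}` of the
    typer's (2.7)–(2.8)/(2.43) tower (`prime (towerRegion bad rad (k−1) 2)` ⊇ `… 6`) with cube size `K₀ = M`, via own
    `B2Eq28RegionsBigBlockUnion.isBigBlockUnion_towerRegion_prime` (p332981) — `prime_towerRegion_six_subset_two`,
    **`eq267_higgs_tower`**, **`eq267_higgs_tower_printed`**, **`eq267_deriv_higgs_tower`**, **`eq267_deriv_higgs_tower_printed`**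
    («`∀ M ≥ Mmin`» = print's «M sufficiently large»; only the cube pair `□₂ ⊇ □₁` stays abstract).

HONEST SCOPE / DIFFERENCES FROM PRINT (recorded, not hidden).  (a) ε-lattice currency of the carrier (`φ^{(k)}` is the
typer's `bgScalar256` = `a_k(Lᵏε)^{−2}G^ε_k(Bᵏ(Λ₂′),A)Q_k^*(A)(Λ₆′φ)`, `G^ε_k = (Lᵏε)²G_k`); the regions `Λ₂′, Λ₆′, □₂, □₁`
are ANY finite sets of `k`-sites with the stated inclusions and big-block property (p35's `IsBigBlockUnion k K₀`, cells of
`LᵏK₀` fine sites, `K₀ ∣ M`, `K₀ ≥ K₀min`) — print's choice (large blocks within `2r`/`4r` of `y`) enters §4 only through the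
two radii hypotheses; for print's own `Λ₂′ ⊇ Λ₆′` (the tower) the big-block hypothesis on `Bᵏ(Λ₂′)` is DISCHARGED with `K₀ = M`
in §6 (v1.1); (b) the regularity (I.2.23) is assumed on `Bᵏ(Λ₂′)` in p35's form with the running coupling
`0 < e_k ≤ e₁` («e(Lᵏε) sufficiently small»); print has it from Lemma 2.3 on `Bᵏ(Λ₋₁^{(k−1)′})`; (c) `R₀` in p35's site form
around `x` with respect to `□`; (d) constants `C₁, C₂, C′` depend on `(d, L, a, m², N, charge, ε₀, c, β)` AND on `K₀` (through
`δ₀ = 1/(4K₀)` and `K_d(δ₀)`), print's «depending on d, a, M»; not optimised; (e) the covariant derivative is the carrier's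
`HiggsLattice.covDeriv C A` on the fine bond `⟨x, x + εe_μ⟩` at the SAME field `A` (print's `D^η_{A^{(k)}}`), ε-lattice currency
(one mesh power `(Lᵏε)^{−1}` relative to the value form, as in (2.58)); (f) nothing about (2.68)–(2.77) (gauging out `A₀`: own
gen 5 `B2Eq268GaugeAway`/`B2Lemma24Proof` on the b04 box) and nothing about (2.65)–(2.66) on this carrier; (g) LOCATED
IMPRECISION (cell GAPS.md `G-B2-p23-01`, owner r02 to adjudicate): print's `□₁, □₂` are «large blocks contained in Λ₇^{(k−1)′}»
near `y`, but `φ^{(k)}` has its sources on `Λ₆′ ⊋ Λ₇′`; for `y` within `2r(Lᵏε)` of `∂Λ₇′` the printed `□₁` omits sources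
`y′ ∈ Λ₆′ ∖ Λ₇′` close to `x`, and the discarded tail `(G_kQ_k^*(Λ₆′ ∖ □₁)φ)(x)` is then `O(1)·sup|φ|`, not `O((Lᵏε)^κ)` — the
hypothesis «`2r(Lᵏε) − s ≤ |x_k − y′|` for `y′ ∈ Λ₆′ ∖ □₁`» of §4 is exactly what the printed choice violates there; building
`□₁, □₂` from the large blocks of `Λ₆′` (still `□ ⊂ Bᵏ(Λ₂′)`, (2.55) still holds on `Λ₋₁′ ⊃ Λ₆′`) repairs it with no change to
(2.68)–(2.77).  This file keeps `□₁ ⊆ □₂ ∩ Λ₆′` ABSTRACT with the radii as explicit hypotheses, so it certifies the repaired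
reading and isolates the printed one's defect.  Value = kernel certificate of one printed proof step on the carrier of record; NOT
summit progress.
-/

namespace Literature.MathematicalPhysics.QuantumFieldTheory.Balaban1983to89.B2Eq267HiggsRegion

open Literature.MathematicalPhysics.QuantumFieldTheory.Balaban1983to89.HiggsLattice (ChargeData covDeriv)
open Literature.MathematicalPhysics.QuantumFieldTheory.Balaban1983to89.HiggsAveraging (blockIter)
open Literature.MathematicalPhysics.QuantumFieldTheory.Balaban1983to89.HiggsCovariance (propagatorK avgQkAdj)
open Literature.MathematicalPhysics.QuantumFieldTheory.Balaban1983to89.B2Eq255Concrete (bgScalar256 bgScalar256_eq cutTo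
  underRegion mem_underRegion)
open Literature.MathematicalPhysics.QuantumFieldTheory.Balaban1983to89.B2Ineq258HiggsRegion (ineq258_GQ_higgs_region_inside
  ineq258_dGQ_higgs_region_inside exp_joint_le blockDistC blockDistC_nonneg)
open Literature.MathematicalPhysics.QuantumFieldTheory.Balaban1983to89.B2Ineq258HiggsTorus (blockDist blockDist_nonneg exp_blockDist_le)
open Literature.MathematicalPhysics.QuantumFieldTheory.Balaban1983to89.B1Ineq234Concrete (distC distC_nonneg)
open Literature.MathematicalPhysics.QuantumFieldTheory.Balaban1983to89.B1TorusRegionHSizes (IsBigBlockUnion)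
open Literature.MathematicalPhysics.QuantumFieldTheory.Balaban1983to89.B1TorusCubeCover (half)
open Literature.MathematicalPhysics.QuantumFieldTheory.Balaban1983to89.B1TorusCubeLocality26 (rS)
open Literature.MathematicalPhysics.QuantumFieldTheory.Balaban1983to89.B2Eq230CondShiftBound (sum_exp_neg_tdist_le)
open Literature.MathematicalPhysics.QuantumFieldTheory.Balaban1983to89.B4Sect5Proof (latticeConst latticeConst_nonneg)
open Literature.MathematicalPhysics.QuantumFieldTheory.Balaban1983to89.B2Eq324NestedRegions (prime mem_prime)
open Literature.MathematicalPhysics.QuantumFieldTheory.Balaban1983to89.B2Eq243RegionsTower (towerRegion towerRegion_antitone)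
open Literature.MathematicalPhysics.QuantumFieldTheory.Balaban1983to89.B2Eq28RegionsBigBlockUnion (isBigBlockUnion_towerRegion_prime)

noncomputable section

variable {P : HiggsLattice.Params} {N : ℕ}

/-! ## §1. (2.56) at a point as a sum over the source blocks `y′ ∈ Λ₆′` -/

/-- `Λφ = Σ_{y∈Λ} φ(y)δ_y` (the cut field as a sum of one-site fields). [cite: Balaban1982Higgs2, (2.56) p.570 «Λ₆^{(k−1)′}φ», dictionary] -/
theorem cutTo_eq_sum {k : ℕ} (Λ : Finset (HiggsLattice.Site P k)) (φ : HiggsLattice.ScalarField P k N) :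
    cutTo Λ φ = ∑ y ∈ Λ, Pi.single y (φ y) := by
  funext x
  rw [Finset.sum_apply]
  by_cases hx : x ∈ Λ
  · rw [B2Eq255Concrete.cutTo_of_mem Λ φ hx, Finset.sum_eq_single x (fun y _ hy => by simp [hy])
      (fun h => (h hx).elim)]
    simp
  · rw [B2Eq255Concrete.cutTo_of_not_mem Λ φ hx]
    exact (Finset.sum_eq_zero fun y hy => by
      have : y ≠ x := fun h => hx (h ▸ hy)
      simp [this]).symm

/-- **(2.56) at a point, block by block**: `φ^{(k)}(x) = a_k(Lᵏε)^{−2} Σ_{y′∈Λ₆′}(G^ε_k(Bᵏ(Λ₂′), A)Q_k^*(A)(φ(y′)δ_{y′}))(x)`.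
[cite: Balaban1982Higgs2, (2.56) p.570] -/
theorem bgScalar256_apply_eq_sum (C : ChargeData N) (msq a : ℝ) (k : ℕ) (Λ₂ Λ₆ : Finset (HiggsLattice.Site P k))
    (A : HiggsLattice.VecField P 0) (φ : HiggsLattice.ScalarField P k N) (x : HiggsLattice.Site P 0) :
    bgScalar256 C msq a k Λ₂ Λ₆ A φ x
      = (B1.aSeq a P.L k * (P.mesh k ^ 2)⁻¹) •
          ∑ y ∈ Λ₆, propagatorK C (underRegion k Λ₂) A msq a k (avgQkAdj C A k (Pi.single y (φ y))) x := by
  rw [bgScalar256_eq, cutTo_eq_sum, map_sum, map_sum, Pi.smul_apply, Finset.sum_apply]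

/-! ## §2. Bookkeeping: two sums against one summable weight; the tail exponent -/

/-- The two-sum bookkeeping behind (2.67): if `‖u′(y) − u(y)‖ ≤ αe(y)` on `S`, `‖u(y)‖ ≤ βe(y)` on `T ∖ S`, `e ≥ 0`,
`Σ_T e ≤ K`, then `‖Σ_T u − Σ_S u′‖ ≤ (α + β)K`. [folklore] -/
private theorem norm_sum_sub_sum_le {ι E : Type*} [SeminormedAddCommGroup E] [DecidableEq ι] (S T : Finset ι)
    (hST : S ⊆ T) (u u' : ι → E) (e : ι → ℝ) (he : ∀ y, 0 ≤ e y) {α β K : ℝ} (hα : 0 ≤ α) (hβ : 0 ≤ β)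
    (h1 : ∀ y ∈ S, ‖u' y - u y‖ ≤ α * e y) (h2 : ∀ y ∈ T \ S, ‖u y‖ ≤ β * e y) (hK : ∑ y ∈ T, e y ≤ K) :
    ‖∑ y ∈ T, u y - ∑ y ∈ S, u' y‖ ≤ (α + β) * K := by
  have hsplit : ∑ y ∈ T, u y - ∑ y ∈ S, u' y = ∑ y ∈ T \ S, u y + ∑ y ∈ S, (u y - u' y) := by
    rw [← Finset.sum_sdiff hST, Finset.sum_sub_distrib]
    abel
  have hS : ∑ y ∈ S, e y ≤ K :=
    (Finset.sum_le_sum_of_subset_of_nonneg hST fun y _ _ => he y).trans hK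
  have hTS : ∑ y ∈ T \ S, e y ≤ K :=
    (Finset.sum_le_sum_of_subset_of_nonneg Finset.sdiff_subset fun y _ _ => he y).trans hK
  rw [hsplit]
  calc ‖∑ y ∈ T \ S, u y + ∑ y ∈ S, (u y - u' y)‖
      ≤ ∑ y ∈ T \ S, ‖u y‖ + ∑ y ∈ S, ‖u y - u' y‖ :=
        (norm_add_le _ _).trans (add_le_add (norm_sum_le _ _) (norm_sum_le _ _))
    _ ≤ ∑ y ∈ T \ S, β * e y + ∑ y ∈ S, α * e y := by
        refine add_le_add (Finset.sum_le_sum fun y hy => h2 y hy) (Finset.sum_le_sum fun y hy => ?_)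
        rw [norm_sub_rev]
        exact h1 y hy
    _ = β * ∑ y ∈ T \ S, e y + α * ∑ y ∈ S, e y := by rw [Finset.mul_sum, Finset.mul_sum]
    _ ≤ β * K + α * K := add_le_add (mul_le_mul_of_nonneg_left hTS hβ) (mul_le_mul_of_nonneg_left hS hα)
    _ = (α + β) * K := by ring

/-- the tail exponent: `e^{−(1/(2K₀))τ} ≤ e^{−(1/(4K₀))ρ}·e^{−(1/(4K₀))τ}` for `τ ≥ ρ`. [folklore] -/
private theorem exp_tail_le (K₀ : ℕ) {ρ τ : ℝ} (h : ρ ≤ τ) :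
    Real.exp (-(1 / (2 * K₀) * τ)) ≤ Real.exp (-(1 / (4 * K₀) * ρ)) * Real.exp (-(1 / (4 * K₀) * τ)) := by
  rw [← Real.exp_add]
  refine Real.exp_le_exp.2 ?_
  have hδ : (0 : ℝ) ≤ 1 / (4 * K₀) := by positivity
  have h2 : (1 : ℝ) / (2 * K₀) = 2 * (1 / (4 * K₀)) := by ring
  rw [h2]
  nlinarith [mul_le_mul_of_nonneg_left h hδ]

/-! ## §3. (2.67): the localization estimate on the carrier, from the two (2.58) clauses for regions -/

/-- **(2.67) ON THE (Higgs)₂,₃ CARRIER — THE LOCALIZATION ESTIMATE** (ε-lattice currency).  For `d ≥ 1`, `L ≥ 2`,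
`a, m² > 0`, `N`, charge data, a mesh cap `ε₀`, a regularity pair `(c, β)` with `β > 0`: there are `K₀min` and, for every
cube size `K₀ ≥ K₀min`, a threshold `e₁ > 0` and constants `C₁, C₂ ≥ 0` such that on every torus of the carrier with `K₀ ∣ M`,
at every level `1 ≤ k ≤ K_P` with `3LᵏK₀ ≤ |T_ε|_μ` and `Lᵏε ≤ ε₀`, for all regions `Λ₆′ ⊆ Λ₂′`, `□₁ ⊆ □₂ ⊆ Λ₂′`, `□₁ ⊆ Λ₆′`
of `T^{(k)}` with `Bᵏ(Λ₂′)` and `□ = Bᵏ(□₂)` big-block unions, every vector field `A` and coupling `0 < e_k ≤ e₁` with (I.2.23)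
on `Bᵏ(Λ₂′)`, every point `x` with `{|z − x| ≤ 2r_S + 2LᵏK₀(d+1) + 1} ⊂ □`, every `φ` with `|φ(y′)| ≤ t` on `Λ₆′` (`t ≥ 0`) and
every `ρ` with `ρ ≤ |x_k − y′|` for all `y′ ∈ Λ₆′ ∖ □₁`:
`‖φ^{(k)}(x) − (a_kG_k(□, A)Q_k^*(A)□₁φ)(x)‖ ≤ a_k·t·[C₁·e^{−(1/(4K₀))·dist(x, □ᶜ)/Lᵏ} + C₂·e^{−(1/(4K₀))·ρ}]`,
both fields being the typer's concrete (2.56) (`bgScalar256 … Λ₂ Λ₆ …` and `bgScalar256 … □₂ □₁ …`).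
[cite: Balaban1982Higgs2, Lemma 2.4 proof (2.67) p.572 «Using Proposition 2.2 and the restrictions (2.55) we get …»]
[cite: Balaban1982Higgs2, Prop. 2.2 (2.58) pp.570–571] [cite: Balaban1982Higgs2, (2.56) p.570] -/
theorem eq267_higgs_region (d L : ℕ) (hd : 1 ≤ d) (hL : 2 ≤ L) {a : ℝ} (ha : 0 < a) {msq : ℝ} (hmsq : 0 < msq)
    (N : ℕ) (C : ChargeData N) (ε₀ : ℝ) (creg β : ℝ) (hcreg : 0 ≤ creg) (hβ : 0 < β) :
    ∃ K₀min : ℕ, ∀ K₀ : ℕ, K₀min ≤ K₀ → ∃ e₁ : ℝ, 0 < e₁ ∧ ∃ C₁ C₂ : ℝ, 0 ≤ C₁ ∧ 0 ≤ C₂ ∧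
      ∀ (P : HiggsLattice.Params), P.d = d → P.L = L → K₀ ∣ P.M →
      ∀ {k : ℕ}, 1 ≤ k → k ≤ P.K → (∀ μ, 3 * half P k K₀ ≤ P.sitesPerDir 0 μ) → P.mesh k ≤ ε₀ →
      ∀ (Λ₂ Λ₆ sq₂ sq₁ : Finset (HiggsLattice.Site P k)), Λ₆ ⊆ Λ₂ → sq₂ ⊆ Λ₂ → sq₁ ⊆ sq₂ → sq₁ ⊆ Λ₆ →
      IsBigBlockUnion k K₀ (underRegion k Λ₂) → IsBigBlockUnion k K₀ (underRegion k sq₂) →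
      ∀ (A : HiggsLattice.VecField P 0) {ec : ℝ}, 0 < ec → ec ≤ e₁ →
      (∀ z ∈ underRegion k Λ₂, ∀ μ ν : Fin P.d,
          P.mesh k * |C.e| / ec * |A ⟨z.shift μ, ν⟩ - A ⟨z, ν⟩| ≤ creg * ec ^ (β - 1) / (P.L : ℝ) ^ k) →
      ∀ (x : HiggsLattice.Site P 0),
        (∀ z, HiggsLattice.Site.tdist x z ≤ 2 * rS P k K₀ + 2 * half P k K₀ * (P.d + 1) + 1 → z ∈ underRegion k sq₂) →
      ∀ (φ : HiggsLattice.ScalarField P k N) (t : ℝ), 0 ≤ t → (∀ y ∈ Λ₆, ‖φ y‖ ≤ t) →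
      ∀ (ρ : ℝ), (∀ y ∈ Λ₆, y ∉ sq₁ → ρ ≤ (HiggsLattice.Site.tdist (blockIter k x) y : ℝ)) →
        ‖bgScalar256 C msq a k Λ₂ Λ₆ A φ x - bgScalar256 C msq a k sq₂ sq₁ A φ x‖
          ≤ B1.aSeq a P.L k * t *
              (C₁ * Real.exp (-(1 / (4 * K₀) * (distC (underRegion k sq₂) x / (P.L : ℝ) ^ k)))
                + C₂ * Real.exp (-(1 / (4 * K₀) * ρ))) := by
  obtain ⟨c₀, hc₀, K₁, hV⟩ := ineq258_GQ_higgs_region_inside d L hd hL ha hmsq N C ε₀ creg β hcreg hβ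
  obtain ⟨c₀', hc₀', K₂, hD⟩ := ineq258_dGQ_higgs_region_inside d L hd hL ha hmsq N C ε₀ creg β hcreg hβ
  refine ⟨max (max K₁ K₂) 1, fun K₀ hK₀ => ?_⟩
  have hK₁ : K₁ ≤ K₀ := (le_max_left _ _).trans ((le_max_left _ _).trans hK₀)
  have hK₂ : K₂ ≤ K₀ := (le_max_right _ _).trans ((le_max_left _ _).trans hK₀)
  have hK₀1 : 1 ≤ K₀ := (le_max_right _ _).trans hK₀
  obtain ⟨e₁, he₁, hV1⟩ := hV K₀ hK₁
  obtain ⟨e₂, he₂, hD1⟩ := hD K₀ hK₂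
  -- the rates and the lattice constant
  have hδpos : (0 : ℝ) < 1 / (4 * K₀) := by
    have : (0 : ℝ) < K₀ := by exact_mod_cast hK₀1
    positivity
  set Kd : ℝ := latticeConst d (1 / (4 * K₀)) with hKd
  have hKd0 : 0 ≤ Kd := latticeConst_nonneg d hδpos.le
  refine ⟨min e₁ e₂, lt_min he₁ he₂, c₀' * Real.exp (1 / (4 * K₀)) * Kd, c₀ * Real.exp (1 / (2 * K₀)) * Kd,
    by positivity, by positivity, ?_⟩
  intro P hPd hPL hK₀M k hk1 hk hsz hε Λ₂ Λ₆ sq₂ sq₁ h62 hs2 hs12 hs16 hΩ hsq A ec hec hle hreg x hx φ t ht hφ ρ hρ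
  -- names
  set Ω := underRegion k Λ₂ with hΩdef
  set Bx := underRegion k sq₂ with hBxdef
  have hBxΩ : Bx ⊆ Ω := by
    intro z hz
    rw [hBxdef, mem_underRegion] at hz
    rw [hΩdef, mem_underRegion]
    exact hs2 hz
  have hxΩ : ∀ z, HiggsLattice.Site.tdist x z ≤ 2 * rS P k K₀ + 2 * half P k K₀ * (P.d + 1) → z ∈ Ω :=
    fun z hz => hBxΩ (hx z (by linarith))
  -- the two per-block bounds
  set u : HiggsLattice.Site P k → EuclideanSpace ℝ (Fin N) :=
    fun y => propagatorK C Ω A msq a k (avgQkAdj C A k (Pi.single y (φ y))) x with hudef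
  set u' : HiggsLattice.Site P k → EuclideanSpace ℝ (Fin N) :=
    fun y => propagatorK C Bx A msq a k (avgQkAdj C A k (Pi.single y (φ y))) x with hu'def
  set e : HiggsLattice.Site P k → ℝ := fun y => Real.exp (-(1 / (4 * K₀) * (HiggsLattice.Site.tdist (blockIter k x) y : ℝ)))
    with hedef
  have he : ∀ y, 0 ≤ e y := fun y => Real.exp_nonneg _
  set α : ℝ := c₀' * P.mesh k ^ 2 * Real.exp (1 / (4 * K₀)) *
    Real.exp (-(1 / (4 * K₀) * (distC Bx x / (P.L : ℝ) ^ k))) * t with hαdef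
  set β' : ℝ := c₀ * P.mesh k ^ 2 * Real.exp (1 / (2 * K₀)) * Real.exp (-(1 / (4 * K₀) * ρ)) * t with hβdef
  have hα : 0 ≤ α := by positivity
  have hβ' : 0 ≤ β' := by positivity
  -- (i) the `δG_k(□, Ω, A)` terms, `y ∈ □₁`
  have h1 : ∀ y ∈ sq₁, ‖u' y - u y‖ ≤ α * e y := by
    intro y hy
    have hyBx : ∀ z : HiggsLattice.Site P 0, blockIter k z = y → z ∈ Bx := by
      intro z hz
      rw [hBxdef, mem_underRegion, hz]
      exact hs12 hy
    have hb := hD1 P hPd hPL hK₀M hk1 hk hsz hε Bx Ω hsq hΩ hBxΩ A hec (hle.trans (min_le_right _ _)) hreg x hx y hyBx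
      (φ y)
    have hj := exp_joint_le hk K₀ Bx x y
    have hdrop : Real.exp (-(1 / (4 * K₀) * ((distC Bx x + blockDistC k Bx y) / (P.L : ℝ) ^ k)))
        ≤ Real.exp (-(1 / (4 * K₀) * (distC Bx x / (P.L : ℝ) ^ k))) := by
      refine Real.exp_le_exp.2 ?_
      have hL0 : (0 : ℝ) < (P.L : ℝ) ^ k := pow_pos (by exact_mod_cast P.hL) k
      have h0 : 0 ≤ blockDistC k Bx y / (P.L : ℝ) ^ k := div_nonneg (blockDistC_nonneg k Bx y) hL0.le
      have : (distC Bx x + blockDistC k Bx y) / (P.L : ℝ) ^ k = distC Bx x / (P.L : ℝ) ^ k + blockDistC k Bx y / (P.L : ℝ) ^ k :=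
        add_div _ _ _
      rw [this]
      nlinarith [hδpos.le]
    have hφy : ‖φ y‖ ≤ t := hφ y (hs16 hy)
    have hm2 : 0 ≤ c₀' * P.mesh k ^ 2 := by positivity
    calc ‖u' y - u y‖
        ≤ c₀' * P.mesh k ^ 2 *
            Real.exp (-((blockDist k x y + distC Bx x + blockDistC k Bx y) / (4 * K₀ * (P.L : ℝ) ^ k))) * ‖φ y‖ := hb
      _ ≤ c₀' * P.mesh k ^ 2 * (Real.exp (1 / (4 * K₀)) * (e y *
            Real.exp (-(1 / (4 * K₀) * (distC Bx x / (P.L : ℝ) ^ k))))) * t := by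
          refine mul_le_mul (mul_le_mul_of_nonneg_left (hj.trans ?_) hm2) hφy (norm_nonneg _) (by positivity)
          exact mul_le_mul_of_nonneg_left (mul_le_mul_of_nonneg_left hdrop (he y)) (Real.exp_nonneg _)
      _ = α * e y := by rw [hαdef]; ring
  -- (ii) the tail terms, `y ∈ Λ₆′ ∖ □₁`
  have h2 : ∀ y ∈ Λ₆ \ sq₁, ‖u y‖ ≤ β' * e y := by
    intro y hy
    rw [Finset.mem_sdiff] at hy
    have hyΩ : ∀ z : HiggsLattice.Site P 0, blockIter k z = y → z ∈ Ω := by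
      intro z hz
      rw [hΩdef, mem_underRegion, hz]
      exact h62 hy.1
    have hb := hV1 P hPd hPL hK₀M hk1 hk hsz hε Ω hΩ A hec (hle.trans (min_le_left _ _)) hreg x hxΩ y hyΩ (φ y)
    have hδ2 : (0 : ℝ) ≤ 1 / (2 * K₀) := by positivity
    have hc := exp_blockDist_le hk hδ2 x y
    have hrew : -(blockDist k x y / (2 * K₀ * (P.L : ℝ) ^ k)) = -(1 / (2 * K₀) * (blockDist k x y / (P.L : ℝ) ^ k)) := by
      rw [div_mul_eq_div_div, one_div_mul_eq_div, div_div, div_div, mul_comm ((P.L : ℝ) ^ k)]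
    rw [hrew] at hb
    have htail := exp_tail_le K₀ (hρ y hy.1 hy.2)
    have hφy : ‖φ y‖ ≤ t := hφ y hy.1
    have hm2 : 0 ≤ c₀ * P.mesh k ^ 2 := by positivity
    calc ‖u y‖
        ≤ c₀ * P.mesh k ^ 2 * Real.exp (-(1 / (2 * K₀) * (blockDist k x y / (P.L : ℝ) ^ k))) * ‖φ y‖ := hb
      _ ≤ c₀ * P.mesh k ^ 2 * (Real.exp (1 / (2 * K₀)) *
            (Real.exp (-(1 / (4 * K₀) * ρ)) * e y)) * t := by
          refine mul_le_mul (mul_le_mul_of_nonneg_left (hc.trans ?_) hm2) hφy (norm_nonneg _) (by positivity)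
          exact mul_le_mul_of_nonneg_left htail (Real.exp_nonneg _)
      _ = β' * e y := by rw [hβdef]; ring
  -- (iii) the lattice sum
  have hsum : ∑ y ∈ Λ₆, e y ≤ Kd := by
    have h := sum_exp_neg_tdist_le (P := P) (k := k) hδpos (blockIter k x)
    rw [hPd] at h
    exact (Finset.sum_le_sum_of_subset_of_nonneg (Finset.subset_univ Λ₆) fun y _ _ => he y).trans h
  -- (iv) assemble
  have hmain := norm_sum_sub_sum_le sq₁ Λ₆ hs16 u u' e he hα hβ' h1 h2 hsum
  have hak : 0 ≤ B1.aSeq a P.L k := by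
    have hL1 : (1 : ℝ) < P.L := by rw [hPL]; exact_mod_cast hL
    exact (B1.aSeq_pos ha hL1 hk1).le
  have hmesh : 0 < P.mesh k := P.mesh_pos k
  have hcoef : 0 ≤ B1.aSeq a P.L k * (P.mesh k ^ 2)⁻¹ := mul_nonneg hak (inv_nonneg.2 (sq_nonneg _))
  rw [bgScalar256_apply_eq_sum, bgScalar256_apply_eq_sum, ← smul_sub, norm_smul, Real.norm_eq_abs,
    abs_of_nonneg hcoef]
  calc B1.aSeq a P.L k * (P.mesh k ^ 2)⁻¹ * ‖∑ y ∈ Λ₆, u y - ∑ y ∈ sq₁, u' y‖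
      ≤ B1.aSeq a P.L k * (P.mesh k ^ 2)⁻¹ * ((α + β') * Kd) := mul_le_mul_of_nonneg_left hmain hcoef
    _ = B1.aSeq a P.L k * t *
          (c₀' * Real.exp (1 / (4 * K₀)) * Kd * Real.exp (-(1 / (4 * K₀) * (distC Bx x / (P.L : ℝ) ^ k)))
            + c₀ * Real.exp (1 / (2 * K₀)) * Kd * Real.exp (-(1 / (4 * K₀) * ρ))) := by
          rw [hαdef, hβdef]
          field_simp


/-! ## §4. The printed `O((Lᵏε)^κ)`: (2.55)₄ on `φ` and print's radii `2r(Lᵏε)`, `4r(Lᵏε)` -/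

/-- **(2.67) AS PRINTED — `φ^{(k)}(x) = (a_kG_k(□, A^{(k)})Q_k^*(A^{(k)})□₁φ)(x) + O((Lᵏε)^κ)`.**  Same data as
`eq267_higgs_region` plus the printed parameter ranges `Q.Printed` (`p > 2`, `r > 1`, `L > 1`, `b₀ > 0`, `R > 0`), a constant
`c₁λ ≥ 0` (`cl`), a slack `s` and an exponent `κ`: there are `K₀min` and, per `K₀ ≥ K₀min`, `e₁ > 0` and `C′` such that — under
(2.55)₄ `|φ(y′)| ≤ c₁λ(L^{k−1}ε)^{−1/4}p(L^{k−1}ε)` on `Λ₆′` (`L^{k−1}ε = (Lᵏε)/L`), `Lᵏε ≤ 1`, and print's geometry in the form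
«`x` lies at least `(2r(Lᵏε) − s)Lᵏ` fine steps inside `□`» and «every `y′ ∈ Λ₆′ ∖ □₁` is at least `2r(Lᵏε) − s` coarse steps
from `x_k`» (print: `□₂ ⊇` the large blocks within `4r(Lᵏε)` of `y`, `□₁ =` those within `2r(Lᵏε)`, `x ∈ Bᵏ(y)`; `s` absorbs the
block diameters) — `‖φ^{(k)}(x) − (a_kG_k(□,A)Q_k^*(A)□₁φ)(x)‖ ≤ C′·a_k·(Lᵏε)^κ`: r14's «`e^{−δ₁r(Lᵏε)}` beats every power»
(`B2StepK.rDecayBeatsPowers_of_printed`, `δ₁ = 2δ₀`) against the polynomial threshold (own gen-7 `printedThreshold_le`).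
[cite: Balaban1982Higgs2, Lemma 2.4 proof (2.67) p.572 «+ O((Lᵏε)^κ), x ∈ Bᵏ(y)»] [cite: Balaban1982Higgs2, (2.55) p.570, (2.7) p.558] -/
theorem eq267_higgs_region_printed (d L : ℕ) (hd : 1 ≤ d) (hL : 2 ≤ L) {a : ℝ} (ha : 0 < a) {msq : ℝ} (hmsq : 0 < msq)
    (N : ℕ) (C : ChargeData N) (ε₀ : ℝ) (creg β : ℝ) (hcreg : 0 ≤ creg) (hβ : 0 < β)
    (Q : B2.Params) (hQ : Q.Printed) {cl : ℝ} (hcl : 0 ≤ cl) (s κ : ℝ) :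
    ∃ K₀min : ℕ, ∀ K₀ : ℕ, K₀min ≤ K₀ → ∃ e₁ : ℝ, 0 < e₁ ∧ ∃ C' : ℝ,
      ∀ (P : HiggsLattice.Params), P.d = d → P.L = L → K₀ ∣ P.M →
      ∀ {k : ℕ}, 1 ≤ k → k ≤ P.K → (∀ μ, 3 * half P k K₀ ≤ P.sitesPerDir 0 μ) → P.mesh k ≤ ε₀ → P.mesh k ≤ 1 →
      ∀ (Λ₂ Λ₆ sq₂ sq₁ : Finset (HiggsLattice.Site P k)), Λ₆ ⊆ Λ₂ → sq₂ ⊆ Λ₂ → sq₁ ⊆ sq₂ → sq₁ ⊆ Λ₆ →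
      IsBigBlockUnion k K₀ (underRegion k Λ₂) → IsBigBlockUnion k K₀ (underRegion k sq₂) →
      ∀ (A : HiggsLattice.VecField P 0) {ec : ℝ}, 0 < ec → ec ≤ e₁ →
      (∀ z ∈ underRegion k Λ₂, ∀ μ ν : Fin P.d,
          P.mesh k * |C.e| / ec * |A ⟨z.shift μ, ν⟩ - A ⟨z, ν⟩| ≤ creg * ec ^ (β - 1) / (P.L : ℝ) ^ k) →
      ∀ (x : HiggsLattice.Site P 0),
        (∀ z, HiggsLattice.Site.tdist x z ≤ 2 * rS P k K₀ + 2 * half P k K₀ * (P.d + 1) + 1 → z ∈ underRegion k sq₂) →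
        (2 * B2.rFn Q.R Q.r (P.mesh k) - s) * (P.L : ℝ) ^ k ≤ distC (underRegion k sq₂) x →
      ∀ (φ : HiggsLattice.ScalarField P k N),
        (∀ y ∈ Λ₆, ‖φ y‖ ≤ cl * (P.mesh k / Q.L) ^ (-(1 / 4 : ℝ)) * B2.pFn Q.b₀ Q.p (P.mesh k / Q.L)) →
        (∀ y ∈ Λ₆, y ∉ sq₁ → 2 * B2.rFn Q.R Q.r (P.mesh k) - s ≤ (HiggsLattice.Site.tdist (blockIter k x) y : ℝ)) →
        ‖bgScalar256 C msq a k Λ₂ Λ₆ A φ x - bgScalar256 C msq a k sq₂ sq₁ A φ x‖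
          ≤ C' * B1.aSeq a P.L k * P.mesh k ^ κ := by
  obtain ⟨K₀min, h⟩ := eq267_higgs_region d L hd hL ha hmsq N C ε₀ creg β hcreg hβ
  obtain ⟨hp2, -, hL1, -, -, -, hb0, -⟩ := id hQ
  refine ⟨max K₀min 1, fun K₀ hK₀ => ?_⟩
  obtain ⟨e₁, he₁, C₁, C₂, hC₁, hC₂, h1⟩ := h K₀ ((le_max_left _ _).trans hK₀)
  have hK₀1 : (1 : ℝ) ≤ K₀ := by exact_mod_cast (le_max_right _ _).trans hK₀
  -- the rates: `δ₀ = 1/(4K₀)`, `δ₁ = 2δ₀` on `r(Lᵏε)`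
  have hδ₀ : (0 : ℝ) < 1 / (4 * K₀) := by positivity
  have hδ₁ : (0 : ℝ) < 2 * (1 / (4 * K₀)) := by positivity
  set m : ℝ := 1 / 4 + Q.p with hm
  have hT : 0 ≤ cl * Q.b₀ * (Q.L : ℝ) ^ m :=
    mul_nonneg (mul_nonneg hcl hb0.le) (Real.rpow_nonneg (Nat.cast_nonneg _) _)
  obtain ⟨Cκ, hCκ⟩ := B2StepK.rDecayBeatsPowers_of_printed Q hQ hδ₁ (κ + m)
  refine ⟨e₁, he₁, (C₁ + C₂) * Real.exp (1 / (4 * K₀) * s) * (cl * Q.b₀ * (Q.L : ℝ) ^ m) * Cκ, ?_⟩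
  intro P hPd hPL hK₀M k hk1 hk hsz hε hℓ1 Λ₂ Λ₆ sq₂ sq₁ h62 hs2 hs12 hs16 hΩ hsq A ec hec hle hreg x hx hdist φ hφ hfar
  set ℓ := P.mesh k with hℓdef
  have hℓ : 0 < ℓ := P.mesh_pos k
  set r := B2.rFn Q.R Q.r ℓ with hrdef
  set t := cl * (ℓ / Q.L) ^ (-(1 / 4 : ℝ)) * B2.pFn Q.b₀ Q.p (ℓ / Q.L) with htdef
  have hQL : (1 : ℝ) ≤ Q.L := by exact_mod_cast hL1.le
  -- the threshold is nonnegative and polynomial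
  have ht0 : 0 ≤ t := by
    have hx : 0 < ℓ / Q.L := div_pos hℓ (by linarith)
    have hx1 : ℓ / Q.L ≤ 1 := by rw [div_le_one (by linarith)]; linarith
    have hp : 0 ≤ B2.pFn Q.b₀ Q.p (ℓ / Q.L) := by
      unfold B2.pFn
      refine mul_nonneg hb0.le (Real.rpow_nonneg ?_ _)
      have : 0 ≤ Real.log (ℓ / Q.L)⁻¹ := Real.log_nonneg ((one_le_inv₀ hx).2 hx1)
      linarith
    exact mul_nonneg (mul_nonneg hcl (Real.rpow_nonneg hx.le _)) hp
  have htT : t ≤ cl * Q.b₀ * (Q.L : ℝ) ^ m * ℓ ^ (-m) :=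
    B2Eq2108ErrorBound.printedThreshold_le hcl hb0.le (by linarith) hQL hℓ hℓ1
  -- the main estimate at `t` and `ρ = 2r − s`
  have hmain := h1 P hPd hPL hK₀M hk1 hk hsz hε Λ₂ Λ₆ sq₂ sq₁ h62 hs2 hs12 hs16 hΩ hsq A hec hle hreg x hx φ t ht0 hφ
    (2 * r - s) hfar
  have hak : 0 ≤ B1.aSeq a P.L k := by
    have hL1' : (1 : ℝ) < P.L := by rw [hPL]; exact_mod_cast hL
    exact (B1.aSeq_pos ha hL1' hk1).le
  -- both exponentials are `≤ e^{δ₀s}·e^{−δ₁r}`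
  have hLk : (0 : ℝ) < (P.L : ℝ) ^ k := pow_pos (by exact_mod_cast P.hL) k
  have hD : 2 * r - s ≤ distC (underRegion k sq₂) x / (P.L : ℝ) ^ k := by
    rw [le_div_iff₀ hLk]; exact hdist
  have hsplit : -(1 / (4 * K₀) * (2 * r - s)) = 1 / (4 * K₀) * s + -(2 * (1 / (4 * K₀)) * r) := by ring
  have hE1 : Real.exp (-(1 / (4 * K₀) * (distC (underRegion k sq₂) x / (P.L : ℝ) ^ k)))
      ≤ Real.exp (1 / (4 * K₀) * s) * Real.exp (-(2 * (1 / (4 * K₀)) * r)) := by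
    rw [← Real.exp_add, ← hsplit]
    exact Real.exp_le_exp.2 (by nlinarith [hδ₀.le])
  have hE2 : Real.exp (-(1 / (4 * K₀) * (2 * r - s)))
      = Real.exp (1 / (4 * K₀) * s) * Real.exp (-(2 * (1 / (4 * K₀)) * r)) := by
    rw [← Real.exp_add, ← hsplit]
  have hdec : Real.exp (-(2 * (1 / (4 * K₀)) * r)) ≤ Cκ * ℓ ^ (κ + m) := hCκ ℓ hℓ hℓ1
  have hpow : ℓ ^ (-m) * ℓ ^ (κ + m) = ℓ ^ κ := by
    rw [← Real.rpow_add hℓ]; ring_nf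
  -- assemble
  set Es : ℝ := Real.exp (1 / (4 * K₀) * s) with hEs
  set Er : ℝ := Real.exp (-(2 * (1 / (4 * K₀)) * r)) with hEr
  have hEs0 : 0 ≤ Es := Real.exp_nonneg _
  have hEr0 : 0 ≤ Er := Real.exp_nonneg _
  calc ‖bgScalar256 C msq a k Λ₂ Λ₆ A φ x - bgScalar256 C msq a k sq₂ sq₁ A φ x‖
      ≤ B1.aSeq a P.L k * t *
          (C₁ * Real.exp (-(1 / (4 * K₀) * (distC (underRegion k sq₂) x / (P.L : ℝ) ^ k)))
            + C₂ * Real.exp (-(1 / (4 * K₀) * (2 * r - s)))) := hmain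
    _ ≤ B1.aSeq a P.L k * t * (C₁ * (Es * Er) + C₂ * (Es * Er)) := by
        refine mul_le_mul_of_nonneg_left (add_le_add (mul_le_mul_of_nonneg_left hE1 hC₁) ?_) (mul_nonneg hak ht0)
        rw [hE2]
    _ = B1.aSeq a P.L k * ((C₁ + C₂) * Es) * (t * Er) := by ring
    _ ≤ B1.aSeq a P.L k * ((C₁ + C₂) * Es) * ((cl * Q.b₀ * (Q.L : ℝ) ^ m * ℓ ^ (-m)) * (Cκ * ℓ ^ (κ + m))) := by
        refine mul_le_mul_of_nonneg_left ?_ (mul_nonneg hak (by positivity))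
        exact mul_le_mul htT hdec hEr0 (mul_nonneg hT (Real.rpow_nonneg hℓ.le _))
    _ = (C₁ + C₂) * Es * (cl * Q.b₀ * (Q.L : ℝ) ^ m) * Cκ * B1.aSeq a P.L k * (ℓ ^ (-m) * ℓ ^ (κ + m)) := by ring
    _ = (C₁ + C₂) * Real.exp (1 / (4 * K₀) * s) * (cl * Q.b₀ * (Q.L : ℝ) ^ m) * Cκ * B1.aSeq a P.L k * P.mesh k ^ κ := by
        rw [hpow]


/-! ## §5. «and the same equality for the covariant derivative of φ^{(k)}»: the `D^ε_A`-form of (2.67) -/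

/-- `D^ε_A(c·u) = c·D^ε_Au`. [cite: Balaban1982Higgs1, (1.7) p.605] -/
theorem covDeriv_smul' (C : ChargeData N) (A : HiggsLattice.VecField P 0) (c : ℝ) (u : HiggsLattice.ScalarField P 0 N)
    (b : HiggsLattice.PBond P 0) : covDeriv C A (c • u) b = c • covDeriv C A u b := by
  unfold covDeriv
  rw [Pi.smul_apply, Pi.smul_apply, map_smul, ← smul_sub, smul_comm]

/-- **(2.56) as a sum over the source blocks, at the level of fields**:
`φ^{(k)} = a_k(Lᵏε)^{−2} Σ_{y′∈Λ₆′} G^ε_k(Bᵏ(Λ₂′), A)Q_k^*(A)(φ(y′)δ_{y′})`. [cite: Balaban1982Higgs2, (2.56) p.570] -/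
theorem bgScalar256_eq_sum (C : ChargeData N) (msq a : ℝ) (k : ℕ) (Λ₂ Λ₆ : Finset (HiggsLattice.Site P k))
    (A : HiggsLattice.VecField P 0) (φ : HiggsLattice.ScalarField P k N) :
    bgScalar256 C msq a k Λ₂ Λ₆ A φ
      = (B1.aSeq a P.L k * (P.mesh k ^ 2)⁻¹) •
          ∑ y ∈ Λ₆, propagatorK C (underRegion k Λ₂) A msq a k (avgQkAdj C A k (Pi.single y (φ y))) := by
  rw [bgScalar256_eq, cutTo_eq_sum, map_sum, map_sum]

/-- **`D^ε_Aφ^{(k)}` at a bond, block by block**: `(D^ε_Aφ^{(k)})(b) = a_k(Lᵏε)^{−2} Σ_{y′∈Λ₆′}(D^ε_A G^ε_k(Bᵏ(Λ₂′),A)Q_k^*(A)(φ(y′)δ_{y′}))(b)`.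
[cite: Balaban1982Higgs2, (2.56) p.570, (2.67) p.572 «the same equality for the covariant derivative»] -/
theorem covDeriv_bgScalar256_eq_sum (C : ChargeData N) (msq a : ℝ) (k : ℕ) (Λ₂ Λ₆ : Finset (HiggsLattice.Site P k))
    (A : HiggsLattice.VecField P 0) (φ : HiggsLattice.ScalarField P k N) (b : HiggsLattice.PBond P 0) :
    covDeriv C A (bgScalar256 C msq a k Λ₂ Λ₆ A φ) b
      = (B1.aSeq a P.L k * (P.mesh k ^ 2)⁻¹) •
          ∑ y ∈ Λ₆, covDeriv C A (propagatorK C (underRegion k Λ₂) A msq a k (avgQkAdj C A k (Pi.single y (φ y)))) b := by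
  rw [bgScalar256_eq_sum, covDeriv_smul', B1Ineq225DerivRegularRegion.covDeriv_sum']

/-- **(2.67), COVARIANT-DERIVATIVE FORM, ON THE (Higgs)₂,₃ CARRIER** — «and the same equality for the covariant derivative of
φ^{(k)}»: same data as `eq267_higgs_region`; for every bond `⟨x, x + εe_μ⟩` with `{|z − x| ≤ 2r_S + 2LᵏK₀(d+1) + 1} ⊂ □`:
`‖(D^ε_Aφ^{(k)})(⟨x,μ⟩) − (D^ε_A a_kG_k(□,A)Q_k^*(A)□₁φ)(⟨x,μ⟩)‖ ≤ a_k·(Lᵏε)^{−1}·t·[C₁·e^{−(1/(4K₀))·dist(x,□ᶜ)/Lᵏ} + C₂·e^{−(1/(4K₀))·ρ}]`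
— from the two `D^η_A`-clauses of (2.58) for regions (own v1.1 `ineq258_DGQ_higgs_region_inside`, v1.2
`ineq258_DdGQ_higgs_region_inside`); one mesh power less than the value form, as (2.58) itself.
[cite: Balaban1982Higgs2, Lemma 2.4 proof (2.67) p.572 «and the same equality for the covariant derivative of φ^{(k)}»]
[cite: Balaban1982Higgs2, Prop. 2.2 (2.58) pp.570–571] -/
theorem eq267_deriv_higgs_region (d L : ℕ) (hd : 1 ≤ d) (hL : 2 ≤ L) {a : ℝ} (ha : 0 < a) {msq : ℝ} (hmsq : 0 < msq)
    (N : ℕ) (C : ChargeData N) (ε₀ : ℝ) (creg β : ℝ) (hcreg : 0 ≤ creg) (hβ : 0 < β) :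
    ∃ K₀min : ℕ, ∀ K₀ : ℕ, K₀min ≤ K₀ → ∃ e₁ : ℝ, 0 < e₁ ∧ ∃ C₁ C₂ : ℝ, 0 ≤ C₁ ∧ 0 ≤ C₂ ∧
      ∀ (P : HiggsLattice.Params), P.d = d → P.L = L → K₀ ∣ P.M →
      ∀ {k : ℕ}, 1 ≤ k → k ≤ P.K → (∀ μ, 3 * half P k K₀ ≤ P.sitesPerDir 0 μ) → P.mesh k ≤ ε₀ →
      ∀ (Λ₂ Λ₆ sq₂ sq₁ : Finset (HiggsLattice.Site P k)), Λ₆ ⊆ Λ₂ → sq₂ ⊆ Λ₂ → sq₁ ⊆ sq₂ → sq₁ ⊆ Λ₆ →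
      IsBigBlockUnion k K₀ (underRegion k Λ₂) → IsBigBlockUnion k K₀ (underRegion k sq₂) →
      ∀ (A : HiggsLattice.VecField P 0) {ec : ℝ}, 0 < ec → ec ≤ e₁ →
      (∀ z ∈ underRegion k Λ₂, ∀ μ ν : Fin P.d,
          P.mesh k * |C.e| / ec * |A ⟨z.shift μ, ν⟩ - A ⟨z, ν⟩| ≤ creg * ec ^ (β - 1) / (P.L : ℝ) ^ k) →
      ∀ (x : HiggsLattice.Site P 0) (μ : Fin P.d),
        (∀ z, HiggsLattice.Site.tdist x z ≤ 2 * rS P k K₀ + 2 * half P k K₀ * (P.d + 1) + 1 → z ∈ underRegion k sq₂) →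
      ∀ (φ : HiggsLattice.ScalarField P k N) (t : ℝ), 0 ≤ t → (∀ y ∈ Λ₆, ‖φ y‖ ≤ t) →
      ∀ (ρ : ℝ), (∀ y ∈ Λ₆, y ∉ sq₁ → ρ ≤ (HiggsLattice.Site.tdist (blockIter k x) y : ℝ)) →
        ‖covDeriv C A (bgScalar256 C msq a k Λ₂ Λ₆ A φ) ⟨x, μ⟩ - covDeriv C A (bgScalar256 C msq a k sq₂ sq₁ A φ) ⟨x, μ⟩‖
          ≤ B1.aSeq a P.L k * (P.mesh k)⁻¹ * t *
              (C₁ * Real.exp (-(1 / (4 * K₀) * (distC (underRegion k sq₂) x / (P.L : ℝ) ^ k)))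
                + C₂ * Real.exp (-(1 / (4 * K₀) * ρ))) := by
  obtain ⟨c₀, hc₀, K₁, hV⟩ := B2Ineq258HiggsRegion.ineq258_DGQ_higgs_region_inside d L hd hL ha hmsq N C ε₀ creg β hcreg hβ
  obtain ⟨c₀', hc₀', K₂, hD⟩ := B2Ineq258HiggsRegion.ineq258_DdGQ_higgs_region_inside d L hd hL ha hmsq N C ε₀ creg β hcreg hβ
  refine ⟨max (max K₁ K₂) 1, fun K₀ hK₀ => ?_⟩
  have hK₁ : K₁ ≤ K₀ := (le_max_left _ _).trans ((le_max_left _ _).trans hK₀)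
  have hK₂ : K₂ ≤ K₀ := (le_max_right _ _).trans ((le_max_left _ _).trans hK₀)
  have hK₀1 : 1 ≤ K₀ := (le_max_right _ _).trans hK₀
  obtain ⟨e₁, he₁, hV1⟩ := hV K₀ hK₁
  obtain ⟨e₂, he₂, hD1⟩ := hD K₀ hK₂
  have hδpos : (0 : ℝ) < 1 / (4 * K₀) := by
    have : (0 : ℝ) < K₀ := by exact_mod_cast hK₀1
    positivity
  set Kd : ℝ := latticeConst d (1 / (4 * K₀)) with hKd
  have hKd0 : 0 ≤ Kd := latticeConst_nonneg d hδpos.le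
  refine ⟨min e₁ e₂, lt_min he₁ he₂, c₀' * Real.exp (1 / (4 * K₀)) * Kd, c₀ * Real.exp (1 / (2 * K₀)) * Kd,
    by positivity, by positivity, ?_⟩
  intro P hPd hPL hK₀M k hk1 hk hsz hε Λ₂ Λ₆ sq₂ sq₁ h62 hs2 hs12 hs16 hΩ hsq A ec hec hle hreg x μ hx φ t ht hφ ρ hρ
  set Ω := underRegion k Λ₂ with hΩdef
  set Bx := underRegion k sq₂ with hBxdef
  have hBxΩ : Bx ⊆ Ω := by
    intro z hz
    rw [hBxdef, mem_underRegion] at hz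
    rw [hΩdef, mem_underRegion]
    exact hs2 hz
  have hxΩ : ∀ z, HiggsLattice.Site.tdist x z ≤ 2 * rS P k K₀ + 2 * half P k K₀ * (P.d + 1) + 1 → z ∈ Ω :=
    fun z hz => hBxΩ (hx z hz)
  set u : HiggsLattice.Site P k → EuclideanSpace ℝ (Fin N) :=
    fun y => covDeriv C A (propagatorK C Ω A msq a k (avgQkAdj C A k (Pi.single y (φ y)))) ⟨x, μ⟩ with hudef
  set u' : HiggsLattice.Site P k → EuclideanSpace ℝ (Fin N) :=
    fun y => covDeriv C A (propagatorK C Bx A msq a k (avgQkAdj C A k (Pi.single y (φ y)))) ⟨x, μ⟩ with hu'def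
  set e : HiggsLattice.Site P k → ℝ :=
    fun y => Real.exp (-(1 / (4 * K₀) * (HiggsLattice.Site.tdist (blockIter k x) y : ℝ))) with hedef
  have he : ∀ y, 0 ≤ e y := fun y => Real.exp_nonneg _
  set α : ℝ := c₀' * P.mesh k * Real.exp (1 / (4 * K₀)) *
    Real.exp (-(1 / (4 * K₀) * (distC Bx x / (P.L : ℝ) ^ k))) * t with hαdef
  set β' : ℝ := c₀ * P.mesh k * Real.exp (1 / (2 * K₀)) * Real.exp (-(1 / (4 * K₀) * ρ)) * t with hβdef
  have hmesh : 0 < P.mesh k := P.mesh_pos k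
  have hα : 0 ≤ α := by positivity
  have hβ' : 0 ≤ β' := by positivity
  -- (i) the `D^ε_A δG_k(□, Ω, A)` terms, `y ∈ □₁`
  have h1 : ∀ y ∈ sq₁, ‖u' y - u y‖ ≤ α * e y := by
    intro y hy
    have hyBx : ∀ z : HiggsLattice.Site P 0, blockIter k z = y → z ∈ Bx := by
      intro z hz
      rw [hBxdef, mem_underRegion, hz]
      exact hs12 hy
    have hb := hD1 P hPd hPL hK₀M hk1 hk hsz hε Bx Ω hsq hΩ hBxΩ A hec (hle.trans (min_le_right _ _)) hreg x μ hx y hyBx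
      (φ y)
    have hj := exp_joint_le hk K₀ Bx x y
    have hdrop : Real.exp (-(1 / (4 * K₀) * ((distC Bx x + blockDistC k Bx y) / (P.L : ℝ) ^ k)))
        ≤ Real.exp (-(1 / (4 * K₀) * (distC Bx x / (P.L : ℝ) ^ k))) := by
      refine Real.exp_le_exp.2 ?_
      have hL0 : (0 : ℝ) < (P.L : ℝ) ^ k := pow_pos (by exact_mod_cast P.hL) k
      have h0 : 0 ≤ blockDistC k Bx y / (P.L : ℝ) ^ k := div_nonneg (blockDistC_nonneg k Bx y) hL0.le
      have : (distC Bx x + blockDistC k Bx y) / (P.L : ℝ) ^ k = distC Bx x / (P.L : ℝ) ^ k + blockDistC k Bx y / (P.L : ℝ) ^ k :=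
        add_div _ _ _
      rw [this]
      nlinarith [hδpos.le]
    have hφy : ‖φ y‖ ≤ t := hφ y (hs16 hy)
    have hm2 : 0 ≤ c₀' * P.mesh k := by positivity
    have hsub : u' y - u y = covDeriv C A (propagatorK C Bx A msq a k (avgQkAdj C A k (Pi.single y (φ y)))
        - propagatorK C Ω A msq a k (avgQkAdj C A k (Pi.single y (φ y)))) ⟨x, μ⟩ := by
      rw [hudef, hu'def, B1Ineq226RegularRegion.covDeriv_sub']
    calc ‖u' y - u y‖
        = ‖covDeriv C A (propagatorK C Bx A msq a k (avgQkAdj C A k (Pi.single y (φ y)))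
            - propagatorK C Ω A msq a k (avgQkAdj C A k (Pi.single y (φ y)))) ⟨x, μ⟩‖ := by rw [hsub]
      _ ≤ c₀' * P.mesh k *
            Real.exp (-((blockDist k x y + distC Bx x + blockDistC k Bx y) / (4 * K₀ * (P.L : ℝ) ^ k))) * ‖φ y‖ := hb
      _ ≤ c₀' * P.mesh k * (Real.exp (1 / (4 * K₀)) * (e y *
            Real.exp (-(1 / (4 * K₀) * (distC Bx x / (P.L : ℝ) ^ k))))) * t := by
          refine mul_le_mul (mul_le_mul_of_nonneg_left (hj.trans ?_) hm2) hφy (norm_nonneg _) (by positivity)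
          exact mul_le_mul_of_nonneg_left (mul_le_mul_of_nonneg_left hdrop (he y)) (Real.exp_nonneg _)
      _ = α * e y := by rw [hαdef]; ring
  -- (ii) the tail terms, `y ∈ Λ₆′ ∖ □₁`
  have h2 : ∀ y ∈ Λ₆ \ sq₁, ‖u y‖ ≤ β' * e y := by
    intro y hy
    rw [Finset.mem_sdiff] at hy
    have hyΩ : ∀ z : HiggsLattice.Site P 0, blockIter k z = y → z ∈ Ω := by
      intro z hz
      rw [hΩdef, mem_underRegion, hz]
      exact h62 hy.1
    have hb := hV1 P hPd hPL hK₀M hk1 hk hsz hε Ω hΩ A hec (hle.trans (min_le_left _ _)) hreg x μ hxΩ y hyΩ (φ y)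
    have hδ2 : (0 : ℝ) ≤ 1 / (2 * K₀) := by positivity
    have hc := exp_blockDist_le hk hδ2 x y
    have hrew : -(blockDist k x y / (2 * K₀ * (P.L : ℝ) ^ k)) = -(1 / (2 * K₀) * (blockDist k x y / (P.L : ℝ) ^ k)) := by
      rw [div_mul_eq_div_div, one_div_mul_eq_div, div_div, div_div, mul_comm ((P.L : ℝ) ^ k)]
    rw [hrew] at hb
    have htail := exp_tail_le K₀ (hρ y hy.1 hy.2)
    have hφy : ‖φ y‖ ≤ t := hφ y hy.1
    have hm2 : 0 ≤ c₀ * P.mesh k := by positivity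
    calc ‖u y‖
        ≤ c₀ * P.mesh k * Real.exp (-(1 / (2 * K₀) * (blockDist k x y / (P.L : ℝ) ^ k))) * ‖φ y‖ := hb
      _ ≤ c₀ * P.mesh k * (Real.exp (1 / (2 * K₀)) *
            (Real.exp (-(1 / (4 * K₀) * ρ)) * e y)) * t := by
          refine mul_le_mul (mul_le_mul_of_nonneg_left (hc.trans ?_) hm2) hφy (norm_nonneg _) (by positivity)
          exact mul_le_mul_of_nonneg_left htail (Real.exp_nonneg _)
      _ = β' * e y := by rw [hβdef]; ring
  -- (iii) the lattice sum
  have hsum : ∑ y ∈ Λ₆, e y ≤ Kd := by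
    have h := sum_exp_neg_tdist_le (P := P) (k := k) hδpos (blockIter k x)
    rw [hPd] at h
    exact (Finset.sum_le_sum_of_subset_of_nonneg (Finset.subset_univ Λ₆) fun y _ _ => he y).trans h
  -- (iv) assemble
  have hmain := norm_sum_sub_sum_le sq₁ Λ₆ hs16 u u' e he hα hβ' h1 h2 hsum
  have hak : 0 ≤ B1.aSeq a P.L k := by
    have hL1 : (1 : ℝ) < P.L := by rw [hPL]; exact_mod_cast hL
    exact (B1.aSeq_pos ha hL1 hk1).le
  have hcoef : 0 ≤ B1.aSeq a P.L k * (P.mesh k ^ 2)⁻¹ := mul_nonneg hak (inv_nonneg.2 (sq_nonneg _))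
  rw [covDeriv_bgScalar256_eq_sum, covDeriv_bgScalar256_eq_sum, ← smul_sub, norm_smul, Real.norm_eq_abs,
    abs_of_nonneg hcoef]
  calc B1.aSeq a P.L k * (P.mesh k ^ 2)⁻¹ * ‖∑ y ∈ Λ₆, u y - ∑ y ∈ sq₁, u' y‖
      ≤ B1.aSeq a P.L k * (P.mesh k ^ 2)⁻¹ * ((α + β') * Kd) := mul_le_mul_of_nonneg_left hmain hcoef
    _ = B1.aSeq a P.L k * (P.mesh k)⁻¹ * t *
          (c₀' * Real.exp (1 / (4 * K₀)) * Kd * Real.exp (-(1 / (4 * K₀) * (distC Bx x / (P.L : ℝ) ^ k)))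
            + c₀ * Real.exp (1 / (2 * K₀)) * Kd * Real.exp (-(1 / (4 * K₀) * ρ))) := by
          rw [hαdef, hβdef]
          field_simp


/-- **(2.67), COVARIANT-DERIVATIVE FORM, AS PRINTED — `O((Lᵏε)^κ)`**: same data and hypotheses as
`eq267_higgs_region_printed`, for every bond `⟨x, x + εe_μ⟩` with `{|z − x| ≤ 2r_S + 2LᵏK₀(d+1) + 1} ⊂ □`:
`‖(D^ε_Aφ^{(k)})(⟨x,μ⟩) − (D^ε_A a_kG_k(□,A)Q_k^*(A)□₁φ)(⟨x,μ⟩)‖ ≤ C′·a_k·(Lᵏε)^κ` for every `κ` (the mesh power `(Lᵏε)^{−1}` of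
the derivative form is absorbed by «decay beats powers» at the exponent `κ + 1`).
[cite: Balaban1982Higgs2, Lemma 2.4 proof (2.67) p.572 «and the same equality for the covariant derivative of φ^{(k)}»]
[cite: Balaban1982Higgs2, (2.55) p.570, (2.7) p.558] -/
theorem eq267_deriv_higgs_region_printed (d L : ℕ) (hd : 1 ≤ d) (hL : 2 ≤ L) {a : ℝ} (ha : 0 < a) {msq : ℝ}
    (hmsq : 0 < msq) (N : ℕ) (C : ChargeData N) (ε₀ : ℝ) (creg β : ℝ) (hcreg : 0 ≤ creg) (hβ : 0 < β)
    (Q : B2.Params) (hQ : Q.Printed) {cl : ℝ} (hcl : 0 ≤ cl) (s κ : ℝ) :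
    ∃ K₀min : ℕ, ∀ K₀ : ℕ, K₀min ≤ K₀ → ∃ e₁ : ℝ, 0 < e₁ ∧ ∃ C' : ℝ,
      ∀ (P : HiggsLattice.Params), P.d = d → P.L = L → K₀ ∣ P.M →
      ∀ {k : ℕ}, 1 ≤ k → k ≤ P.K → (∀ μ, 3 * half P k K₀ ≤ P.sitesPerDir 0 μ) → P.mesh k ≤ ε₀ → P.mesh k ≤ 1 →
      ∀ (Λ₂ Λ₆ sq₂ sq₁ : Finset (HiggsLattice.Site P k)), Λ₆ ⊆ Λ₂ → sq₂ ⊆ Λ₂ → sq₁ ⊆ sq₂ → sq₁ ⊆ Λ₆ →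
      IsBigBlockUnion k K₀ (underRegion k Λ₂) → IsBigBlockUnion k K₀ (underRegion k sq₂) →
      ∀ (A : HiggsLattice.VecField P 0) {ec : ℝ}, 0 < ec → ec ≤ e₁ →
      (∀ z ∈ underRegion k Λ₂, ∀ μ ν : Fin P.d,
          P.mesh k * |C.e| / ec * |A ⟨z.shift μ, ν⟩ - A ⟨z, ν⟩| ≤ creg * ec ^ (β - 1) / (P.L : ℝ) ^ k) →
      ∀ (x : HiggsLattice.Site P 0) (μ : Fin P.d),
        (∀ z, HiggsLattice.Site.tdist x z ≤ 2 * rS P k K₀ + 2 * half P k K₀ * (P.d + 1) + 1 → z ∈ underRegion k sq₂) →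
        (2 * B2.rFn Q.R Q.r (P.mesh k) - s) * (P.L : ℝ) ^ k ≤ distC (underRegion k sq₂) x →
      ∀ (φ : HiggsLattice.ScalarField P k N),
        (∀ y ∈ Λ₆, ‖φ y‖ ≤ cl * (P.mesh k / Q.L) ^ (-(1 / 4 : ℝ)) * B2.pFn Q.b₀ Q.p (P.mesh k / Q.L)) →
        (∀ y ∈ Λ₆, y ∉ sq₁ → 2 * B2.rFn Q.R Q.r (P.mesh k) - s ≤ (HiggsLattice.Site.tdist (blockIter k x) y : ℝ)) →
        ‖covDeriv C A (bgScalar256 C msq a k Λ₂ Λ₆ A φ) ⟨x, μ⟩ - covDeriv C A (bgScalar256 C msq a k sq₂ sq₁ A φ) ⟨x, μ⟩‖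
          ≤ C' * B1.aSeq a P.L k * P.mesh k ^ κ := by
  obtain ⟨K₀min, h⟩ := eq267_deriv_higgs_region d L hd hL ha hmsq N C ε₀ creg β hcreg hβ
  obtain ⟨hp2, -, hL1, -, -, -, hb0, -⟩ := id hQ
  refine ⟨max K₀min 1, fun K₀ hK₀ => ?_⟩
  obtain ⟨e₁, he₁, C₁, C₂, hC₁, hC₂, h1⟩ := h K₀ ((le_max_left _ _).trans hK₀)
  have hK₀1 : (1 : ℝ) ≤ K₀ := by exact_mod_cast (le_max_right _ _).trans hK₀
  have hδ₀ : (0 : ℝ) < 1 / (4 * K₀) := by positivity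
  have hδ₁ : (0 : ℝ) < 2 * (1 / (4 * K₀)) := by positivity
  set m : ℝ := 1 / 4 + Q.p with hm
  have hT : 0 ≤ cl * Q.b₀ * (Q.L : ℝ) ^ m :=
    mul_nonneg (mul_nonneg hcl hb0.le) (Real.rpow_nonneg (Nat.cast_nonneg _) _)
  obtain ⟨Cκ, hCκ⟩ := B2StepK.rDecayBeatsPowers_of_printed Q hQ hδ₁ (κ + 1 + m)
  refine ⟨e₁, he₁, (C₁ + C₂) * Real.exp (1 / (4 * K₀) * s) * (cl * Q.b₀ * (Q.L : ℝ) ^ m) * Cκ, ?_⟩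
  intro P hPd hPL hK₀M k hk1 hk hsz hε hℓ1 Λ₂ Λ₆ sq₂ sq₁ h62 hs2 hs12 hs16 hΩ hsq A ec hec hle hreg x μ hx hdist φ hφ hfar
  set ℓ := P.mesh k with hℓdef
  have hℓ : 0 < ℓ := P.mesh_pos k
  set r := B2.rFn Q.R Q.r ℓ with hrdef
  set t := cl * (ℓ / Q.L) ^ (-(1 / 4 : ℝ)) * B2.pFn Q.b₀ Q.p (ℓ / Q.L) with htdef
  have hQL : (1 : ℝ) ≤ Q.L := by exact_mod_cast hL1.le
  have ht0 : 0 ≤ t := by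
    have hx : 0 < ℓ / Q.L := div_pos hℓ (by linarith)
    have hx1 : ℓ / Q.L ≤ 1 := by rw [div_le_one (by linarith)]; linarith
    have hp : 0 ≤ B2.pFn Q.b₀ Q.p (ℓ / Q.L) := by
      unfold B2.pFn
      refine mul_nonneg hb0.le (Real.rpow_nonneg ?_ _)
      have : 0 ≤ Real.log (ℓ / Q.L)⁻¹ := Real.log_nonneg ((one_le_inv₀ hx).2 hx1)
      linarith
    exact mul_nonneg (mul_nonneg hcl (Real.rpow_nonneg hx.le _)) hp
  have htT : t ≤ cl * Q.b₀ * (Q.L : ℝ) ^ m * ℓ ^ (-m) :=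
    B2Eq2108ErrorBound.printedThreshold_le hcl hb0.le (by linarith) hQL hℓ hℓ1
  have hmain := h1 P hPd hPL hK₀M hk1 hk hsz hε Λ₂ Λ₆ sq₂ sq₁ h62 hs2 hs12 hs16 hΩ hsq A hec hle hreg x μ hx φ t ht0 hφ
    (2 * r - s) hfar
  have hak : 0 ≤ B1.aSeq a P.L k := by
    have hL1' : (1 : ℝ) < P.L := by rw [hPL]; exact_mod_cast hL
    exact (B1.aSeq_pos ha hL1' hk1).le
  have hLk : (0 : ℝ) < (P.L : ℝ) ^ k := pow_pos (by exact_mod_cast P.hL) k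
  have hD : 2 * r - s ≤ distC (underRegion k sq₂) x / (P.L : ℝ) ^ k := by
    rw [le_div_iff₀ hLk]; exact hdist
  have hsplit : -(1 / (4 * K₀) * (2 * r - s)) = 1 / (4 * K₀) * s + -(2 * (1 / (4 * K₀)) * r) := by ring
  have hE1 : Real.exp (-(1 / (4 * K₀) * (distC (underRegion k sq₂) x / (P.L : ℝ) ^ k)))
      ≤ Real.exp (1 / (4 * K₀) * s) * Real.exp (-(2 * (1 / (4 * K₀)) * r)) := by
    rw [← Real.exp_add, ← hsplit]
    exact Real.exp_le_exp.2 (by nlinarith [hδ₀.le])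
  have hE2 : Real.exp (-(1 / (4 * K₀) * (2 * r - s)))
      = Real.exp (1 / (4 * K₀) * s) * Real.exp (-(2 * (1 / (4 * K₀)) * r)) := by
    rw [← Real.exp_add, ← hsplit]
  have hdec : Real.exp (-(2 * (1 / (4 * K₀)) * r)) ≤ Cκ * ℓ ^ (κ + 1 + m) := hCκ ℓ hℓ hℓ1
  have hpow : ℓ⁻¹ * (ℓ ^ (-m) * ℓ ^ (κ + 1 + m)) = ℓ ^ κ := by
    rw [← Real.rpow_neg_one ℓ, ← Real.rpow_add hℓ, ← Real.rpow_add hℓ]; ring_nf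
  set Es : ℝ := Real.exp (1 / (4 * K₀) * s) with hEs
  set Er : ℝ := Real.exp (-(2 * (1 / (4 * K₀)) * r)) with hEr
  have hEs0 : 0 ≤ Es := Real.exp_nonneg _
  have hEr0 : 0 ≤ Er := Real.exp_nonneg _
  have hℓi : 0 ≤ ℓ⁻¹ := inv_nonneg.2 hℓ.le
  calc ‖covDeriv C A (bgScalar256 C msq a k Λ₂ Λ₆ A φ) ⟨x, μ⟩ - covDeriv C A (bgScalar256 C msq a k sq₂ sq₁ A φ) ⟨x, μ⟩‖
      ≤ B1.aSeq a P.L k * ℓ⁻¹ * t *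
          (C₁ * Real.exp (-(1 / (4 * K₀) * (distC (underRegion k sq₂) x / (P.L : ℝ) ^ k)))
            + C₂ * Real.exp (-(1 / (4 * K₀) * (2 * r - s)))) := hmain
    _ ≤ B1.aSeq a P.L k * ℓ⁻¹ * t * (C₁ * (Es * Er) + C₂ * (Es * Er)) := by
        refine mul_le_mul_of_nonneg_left (add_le_add (mul_le_mul_of_nonneg_left hE1 hC₁) ?_)
          (mul_nonneg (mul_nonneg hak hℓi) ht0)
        rw [hE2]
    _ = B1.aSeq a P.L k * ℓ⁻¹ * ((C₁ + C₂) * Es) * (t * Er) := by ring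
    _ ≤ B1.aSeq a P.L k * ℓ⁻¹ * ((C₁ + C₂) * Es) *
          ((cl * Q.b₀ * (Q.L : ℝ) ^ m * ℓ ^ (-m)) * (Cκ * ℓ ^ (κ + 1 + m))) := by
        refine mul_le_mul_of_nonneg_left ?_ (mul_nonneg (mul_nonneg hak hℓi) (by positivity))
        exact mul_le_mul htT hdec hEr0 (mul_nonneg hT (Real.rpow_nonneg hℓ.le _))
    _ = (C₁ + C₂) * Es * (cl * Q.b₀ * (Q.L : ℝ) ^ m) * Cκ * B1.aSeq a P.L k * (ℓ⁻¹ * (ℓ ^ (-m) * ℓ ^ (κ + 1 + m))) := by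
        ring
    _ = (C₁ + C₂) * Real.exp (1 / (4 * K₀) * s) * (cl * Q.b₀ * (Q.L : ℝ) ^ m) * Cκ * B1.aSeq a P.L k * P.mesh k ^ κ := by
        rw [hpow]


/-! ## §6. (v1.1) Print's own regions: `Λ₂′ = Λ₂^{(k−1)′} ⊇ Λ₆′ = Λ₆^{(k−1)′}` of the (2.7)–(2.8)/(2.43) tower, cube size `K₀ = M`

In §§3–5 the regions `Λ₂ ⊇ Λ₆` are arbitrary finite sets of `k`-sites with `Bᵏ(Λ₂)` a big-block union of cube size `K₀`
(`K₀ ∣ M`).  Print's regions are the tower sets `Λ_i^{(k−1)′}` — the typer's `prime (towerRegion bad rad (k−1) i)`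
(`B2Eq243RegionsTower`, (2.7)–(2.8) p.558 / (2.43) p.566 / p.570) — and for them own `B2Eq28RegionsBigBlockUnion` (p332981)
shows `Bᵏ(Λ_i^{(k−1)′})` IS a big-block union at level `k` with cube size exactly `M` (`isBigBlockUnion_towerRegion_prime`),
while `Λ₆′ ⊆ Λ₂′` is the tower's monotonicity in `i` (`towerRegion_antitone`, for `rad (k−1) ≥ 0`).  The four theorems below
are §§3–5 so instantiated, level `k = j + 1`, `K₀ := M`: the quantifier «`∀ K₀ ≥ K₀min … K₀ ∣ M`» becomes print's «`M`
sufficiently large» («`∀ M ≥ Mmin`», the torus having `P.M = M`), and only the cube pair `□₂ ⊇ □₁` stays abstract — `□₂ ⊆ Λ₂′`,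
`□₁ ⊆ □₂ ∩ Λ₆′`, `Bᵏ(□₂)` a big-block union of cube size `M` (for `□₂ = prime □` with `□` a union of large blocks of `T^{(k−1)}`
this is `B2Eq28RegionsBigBlockUnion.isBigBlockUnion_underRegion_prime`; for `□₂` a union of large blocks of `T^{(k)}` it is
`isBigBlockUnion_underRegion_M`).  [cite: Balaban1982Higgs2, (2.56) p.570 «G_k(Bᵏ(Λ₂^{(k−1)′}), A^{(k)}) … Λ₆^{(k−1)′}φ»,
Lemma 2.4 proof p.572 «□₂ … contained in Λ₇^{(k−1)′}»] [cite: Balaban1982Higgs1, Prop. 2.1 p.610 «let Ω^{(k)} ⊂ T^{(k)}_1 be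
a sum of big blocks with M sufficiently large»] -/

/-- `Λ ⊆ Λ′ ⟹ Λ′ ⊆ Λ′′` for the primes ((3.22): the `(k+1)`-sites whose whole block lies in the set).
[cite: Balaban1982Higgs2, (3.22) p.588, dictionary] -/
private theorem prime_mono {l : ℕ} {Λ Λ' : Finset (HiggsLattice.Site P l)} (h : Λ ⊆ Λ') : prime Λ ⊆ prime Λ' :=
  fun y hy => (mem_prime Λ' y).mpr fun x hx => h ((mem_prime Λ y).mp hy x hx)

/-- `Λ₆^{(j)′} ⊆ Λ₂^{(j)′}` for the typer's tower when `rad j ≥ 0`. [cite: Balaban1982Higgs2, (2.8) p.558 «Λ_{i+1} ⊂ Λ_i», (2.43) p.566] -/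
theorem prime_towerRegion_six_subset_two (bad : (l : ℕ) → Set (HiggsLattice.Site P l)) {rad : ℕ → ℝ} {j : ℕ}
    (hrad : 0 ≤ rad j) : prime (towerRegion bad rad j 6) ⊆ prime (towerRegion bad rad j 2) :=
  prime_mono (towerRegion_antitone (bad := bad) hrad (by norm_num))

/-- **(2.67) ON THE CARRIER FOR PRINT'S OWN REGIONS `Λ₂^{(k−1)′} ⊇ Λ₆^{(k−1)′}` (the (2.7)–(2.8)/(2.43) tower), `K₀ = M`.**
`eq267_higgs_region` at `Λ₂ := Λ₂^{(j)′}`, `Λ₆ := Λ₆^{(j)′}` (`prime (towerRegion bad rad j 2)`, `… 6`), level `k = j + 1`,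
cube size `M`: for `M ≥ Mmin` there are `e₁ > 0`, `C₁, C₂ ≥ 0` such that on every torus of the family with `P.M = M`, for
`A` regular on `Bᵏ(Λ₂′)`, `|φ| ≤ t` on `Λ₆′`, cubes `□₁ ⊆ □₂ ⊆ Λ₂′`, `□₁ ⊆ Λ₆′`, `Bᵏ(□₂)` a big-block union of cube size `M`,
`x` with the `(R₀+1)`-ball in `□ = Bᵏ(□₂)` and `ρ ≤ |x_k − y′|` off `□₁`:
`‖φ^{(k)}(x) − (a_kG_k(□,A)Q_k^*(A)□₁φ)(x)‖ ≤ a_k·t·[C₁e^{−dist(x,□ᶜ)/(4MLᵏ)} + C₂e^{−ρ/(4M)}]`.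
[cite: Balaban1982Higgs2, Lemma 2.4 proof (2.67) p.572] [cite: Balaban1982Higgs2, (2.56) p.570, (2.7)–(2.8) p.558, (2.43) p.566]
[cite: Balaban1982Higgs1, Prop. 2.1 p.610] -/
theorem eq267_higgs_tower (d L : ℕ) (hd : 1 ≤ d) (hL : 2 ≤ L) {a : ℝ} (ha : 0 < a) {msq : ℝ} (hmsq : 0 < msq)
    (N : ℕ) (C : ChargeData N) (ε₀ : ℝ) (creg β : ℝ) (hcreg : 0 ≤ creg) (hβ : 0 < β) :
    ∃ Mmin : ℕ, ∀ M : ℕ, Mmin ≤ M → ∃ e₁ : ℝ, 0 < e₁ ∧ ∃ C₁ C₂ : ℝ, 0 ≤ C₁ ∧ 0 ≤ C₂ ∧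
      ∀ (P : HiggsLattice.Params), P.d = d → P.L = L → P.M = M →
      ∀ {j : ℕ}, j + 1 ≤ P.K → (∀ μ, 3 * half P (j + 1) M ≤ P.sitesPerDir 0 μ) → P.mesh (j + 1) ≤ ε₀ →
      ∀ (bad : (l : ℕ) → Set (HiggsLattice.Site P l)) (rad : ℕ → ℝ), 0 ≤ rad j →
      ∀ (sq₂ sq₁ : Finset (HiggsLattice.Site P (j + 1))), sq₂ ⊆ prime (towerRegion bad rad j 2) → sq₁ ⊆ sq₂ →
        sq₁ ⊆ prime (towerRegion bad rad j 6) → IsBigBlockUnion (j + 1) M (underRegion (j + 1) sq₂) →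
      ∀ (A : HiggsLattice.VecField P 0) {ec : ℝ}, 0 < ec → ec ≤ e₁ →
      (∀ z ∈ underRegion (j + 1) (prime (towerRegion bad rad j 2)), ∀ μ ν : Fin P.d,
          P.mesh (j + 1) * |C.e| / ec * |A ⟨z.shift μ, ν⟩ - A ⟨z, ν⟩| ≤ creg * ec ^ (β - 1) / (P.L : ℝ) ^ (j + 1)) →
      ∀ (x : HiggsLattice.Site P 0),
        (∀ z, HiggsLattice.Site.tdist x z ≤ 2 * rS P (j + 1) M + 2 * half P (j + 1) M * (P.d + 1) + 1 →
          z ∈ underRegion (j + 1) sq₂) →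
      ∀ (φ : HiggsLattice.ScalarField P (j + 1) N) (t : ℝ), 0 ≤ t → (∀ y ∈ prime (towerRegion bad rad j 6), ‖φ y‖ ≤ t) →
      ∀ (ρ : ℝ), (∀ y ∈ prime (towerRegion bad rad j 6), y ∉ sq₁ →
          ρ ≤ (HiggsLattice.Site.tdist (blockIter (j + 1) x) y : ℝ)) →
        ‖bgScalar256 C msq a (j + 1) (prime (towerRegion bad rad j 2)) (prime (towerRegion bad rad j 6)) A φ x
            - bgScalar256 C msq a (j + 1) sq₂ sq₁ A φ x‖
          ≤ B1.aSeq a P.L (j + 1) * t *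
              (C₁ * Real.exp (-(1 / (4 * M) * (distC (underRegion (j + 1) sq₂) x / (P.L : ℝ) ^ (j + 1))))
                + C₂ * Real.exp (-(1 / (4 * M) * ρ))) := by
  obtain ⟨K₀min, h⟩ := eq267_higgs_region d L hd hL ha hmsq N C ε₀ creg β hcreg hβ
  refine ⟨K₀min, fun M hM => ?_⟩
  obtain ⟨e₁, he₁, C₁, C₂, hC₁, hC₂, h1⟩ := h M hM
  refine ⟨e₁, he₁, C₁, C₂, hC₁, hC₂, ?_⟩
  intro P hPd hPL hPM j hk hsz hε bad rad hrad sq₂ sq₁ hs2 hs12 hs16 hsq A ec hec hle hreg x hx φ t ht hφ ρ hρ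
  have hdvd : M ∣ P.M := hPM ▸ dvd_refl _
  have hΩ : IsBigBlockUnion (j + 1) M (underRegion (j + 1) (prime (towerRegion bad rad j 2))) :=
    hPM ▸ isBigBlockUnion_towerRegion_prime bad rad j 2
  exact h1 P hPd hPL hdvd (Nat.succ_le_succ (Nat.zero_le j)) hk hsz hε _ _ sq₂ sq₁
    (prime_towerRegion_six_subset_two bad hrad) hs2 hs12 hs16 hΩ hsq A hec hle hreg x hx φ t ht hφ ρ hρ

/-- **(2.67) AS PRINTED, `O((Lᵏε)^κ)`, FOR PRINT'S OWN REGIONS, `K₀ = M`**: `eq267_higgs_region_printed` at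
`Λ₂ := Λ₂^{(j)′}`, `Λ₆ := Λ₆^{(j)′}`, `k = j + 1`, cube size `M` — under (2.55)₄ on `Λ₆′` and print's radii,
`‖φ^{(k)}(x) − (a_kG_k(□,A)Q_k^*(A)□₁φ)(x)‖ ≤ C′·a_k·(Lᵏε)^κ`.
[cite: Balaban1982Higgs2, Lemma 2.4 proof (2.67) p.572 «+ O((Lᵏε)^κ), x ∈ Bᵏ(y)»] [cite: Balaban1982Higgs2, (2.55) p.570, (2.7)–(2.8) p.558]
[cite: Balaban1982Higgs1, Prop. 2.1 p.610] -/
theorem eq267_higgs_tower_printed (d L : ℕ) (hd : 1 ≤ d) (hL : 2 ≤ L) {a : ℝ} (ha : 0 < a) {msq : ℝ} (hmsq : 0 < msq)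
    (N : ℕ) (C : ChargeData N) (ε₀ : ℝ) (creg β : ℝ) (hcreg : 0 ≤ creg) (hβ : 0 < β)
    (Q : B2.Params) (hQ : Q.Printed) {cl : ℝ} (hcl : 0 ≤ cl) (s κ : ℝ) :
    ∃ Mmin : ℕ, ∀ M : ℕ, Mmin ≤ M → ∃ e₁ : ℝ, 0 < e₁ ∧ ∃ C' : ℝ,
      ∀ (P : HiggsLattice.Params), P.d = d → P.L = L → P.M = M →
      ∀ {j : ℕ}, j + 1 ≤ P.K → (∀ μ, 3 * half P (j + 1) M ≤ P.sitesPerDir 0 μ) → P.mesh (j + 1) ≤ ε₀ →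
        P.mesh (j + 1) ≤ 1 →
      ∀ (bad : (l : ℕ) → Set (HiggsLattice.Site P l)) (rad : ℕ → ℝ), 0 ≤ rad j →
      ∀ (sq₂ sq₁ : Finset (HiggsLattice.Site P (j + 1))), sq₂ ⊆ prime (towerRegion bad rad j 2) → sq₁ ⊆ sq₂ →
        sq₁ ⊆ prime (towerRegion bad rad j 6) → IsBigBlockUnion (j + 1) M (underRegion (j + 1) sq₂) →
      ∀ (A : HiggsLattice.VecField P 0) {ec : ℝ}, 0 < ec → ec ≤ e₁ →
      (∀ z ∈ underRegion (j + 1) (prime (towerRegion bad rad j 2)), ∀ μ ν : Fin P.d,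
          P.mesh (j + 1) * |C.e| / ec * |A ⟨z.shift μ, ν⟩ - A ⟨z, ν⟩| ≤ creg * ec ^ (β - 1) / (P.L : ℝ) ^ (j + 1)) →
      ∀ (x : HiggsLattice.Site P 0),
        (∀ z, HiggsLattice.Site.tdist x z ≤ 2 * rS P (j + 1) M + 2 * half P (j + 1) M * (P.d + 1) + 1 →
          z ∈ underRegion (j + 1) sq₂) →
        (2 * B2.rFn Q.R Q.r (P.mesh (j + 1)) - s) * (P.L : ℝ) ^ (j + 1) ≤ distC (underRegion (j + 1) sq₂) x →
      ∀ (φ : HiggsLattice.ScalarField P (j + 1) N),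
        (∀ y ∈ prime (towerRegion bad rad j 6),
          ‖φ y‖ ≤ cl * (P.mesh (j + 1) / Q.L) ^ (-(1 / 4 : ℝ)) * B2.pFn Q.b₀ Q.p (P.mesh (j + 1) / Q.L)) →
        (∀ y ∈ prime (towerRegion bad rad j 6), y ∉ sq₁ →
          2 * B2.rFn Q.R Q.r (P.mesh (j + 1)) - s ≤ (HiggsLattice.Site.tdist (blockIter (j + 1) x) y : ℝ)) →
        ‖bgScalar256 C msq a (j + 1) (prime (towerRegion bad rad j 2)) (prime (towerRegion bad rad j 6)) A φ x
            - bgScalar256 C msq a (j + 1) sq₂ sq₁ A φ x‖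
          ≤ C' * B1.aSeq a P.L (j + 1) * P.mesh (j + 1) ^ κ := by
  obtain ⟨K₀min, h⟩ := eq267_higgs_region_printed d L hd hL ha hmsq N C ε₀ creg β hcreg hβ Q hQ hcl s κ
  refine ⟨K₀min, fun M hM => ?_⟩
  obtain ⟨e₁, he₁, C', h1⟩ := h M hM
  refine ⟨e₁, he₁, C', ?_⟩
  intro P hPd hPL hPM j hk hsz hε hℓ1 bad rad hrad sq₂ sq₁ hs2 hs12 hs16 hsq A ec hec hle hreg x hx hdist φ hφ hfar
  have hdvd : M ∣ P.M := hPM ▸ dvd_refl _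
  have hΩ : IsBigBlockUnion (j + 1) M (underRegion (j + 1) (prime (towerRegion bad rad j 2))) :=
    hPM ▸ isBigBlockUnion_towerRegion_prime bad rad j 2
  exact h1 P hPd hPL hdvd (Nat.succ_le_succ (Nat.zero_le j)) hk hsz hε hℓ1 _ _ sq₂ sq₁
    (prime_towerRegion_six_subset_two bad hrad) hs2 hs12 hs16 hΩ hsq A hec hle hreg x hx hdist φ hφ hfar

/-- **(2.67), COVARIANT-DERIVATIVE FORM, FOR PRINT'S OWN REGIONS, `K₀ = M`**: `eq267_deriv_higgs_region` at
`Λ₂ := Λ₂^{(j)′}`, `Λ₆ := Λ₆^{(j)′}`, `k = j + 1`, cube size `M`.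
[cite: Balaban1982Higgs2, Lemma 2.4 proof (2.67) p.572 «and the same equality for the covariant derivative of φ^{(k)}»]
[cite: Balaban1982Higgs2, (2.56) p.570, (2.7)–(2.8) p.558] [cite: Balaban1982Higgs1, Prop. 2.1 p.610] -/
theorem eq267_deriv_higgs_tower (d L : ℕ) (hd : 1 ≤ d) (hL : 2 ≤ L) {a : ℝ} (ha : 0 < a) {msq : ℝ} (hmsq : 0 < msq)
    (N : ℕ) (C : ChargeData N) (ε₀ : ℝ) (creg β : ℝ) (hcreg : 0 ≤ creg) (hβ : 0 < β) :
    ∃ Mmin : ℕ, ∀ M : ℕ, Mmin ≤ M → ∃ e₁ : ℝ, 0 < e₁ ∧ ∃ C₁ C₂ : ℝ, 0 ≤ C₁ ∧ 0 ≤ C₂ ∧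
      ∀ (P : HiggsLattice.Params), P.d = d → P.L = L → P.M = M →
      ∀ {j : ℕ}, j + 1 ≤ P.K → (∀ μ, 3 * half P (j + 1) M ≤ P.sitesPerDir 0 μ) → P.mesh (j + 1) ≤ ε₀ →
      ∀ (bad : (l : ℕ) → Set (HiggsLattice.Site P l)) (rad : ℕ → ℝ), 0 ≤ rad j →
      ∀ (sq₂ sq₁ : Finset (HiggsLattice.Site P (j + 1))), sq₂ ⊆ prime (towerRegion bad rad j 2) → sq₁ ⊆ sq₂ →
        sq₁ ⊆ prime (towerRegion bad rad j 6) → IsBigBlockUnion (j + 1) M (underRegion (j + 1) sq₂) →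
      ∀ (A : HiggsLattice.VecField P 0) {ec : ℝ}, 0 < ec → ec ≤ e₁ →
      (∀ z ∈ underRegion (j + 1) (prime (towerRegion bad rad j 2)), ∀ μ ν : Fin P.d,
          P.mesh (j + 1) * |C.e| / ec * |A ⟨z.shift μ, ν⟩ - A ⟨z, ν⟩| ≤ creg * ec ^ (β - 1) / (P.L : ℝ) ^ (j + 1)) →
      ∀ (x : HiggsLattice.Site P 0) (μ : Fin P.d),
        (∀ z, HiggsLattice.Site.tdist x z ≤ 2 * rS P (j + 1) M + 2 * half P (j + 1) M * (P.d + 1) + 1 →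
          z ∈ underRegion (j + 1) sq₂) →
      ∀ (φ : HiggsLattice.ScalarField P (j + 1) N) (t : ℝ), 0 ≤ t → (∀ y ∈ prime (towerRegion bad rad j 6), ‖φ y‖ ≤ t) →
      ∀ (ρ : ℝ), (∀ y ∈ prime (towerRegion bad rad j 6), y ∉ sq₁ →
          ρ ≤ (HiggsLattice.Site.tdist (blockIter (j + 1) x) y : ℝ)) →
        ‖covDeriv C A (bgScalar256 C msq a (j + 1) (prime (towerRegion bad rad j 2)) (prime (towerRegion bad rad j 6)) A φ) ⟨x, μ⟩
            - covDeriv C A (bgScalar256 C msq a (j + 1) sq₂ sq₁ A φ) ⟨x, μ⟩‖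
          ≤ B1.aSeq a P.L (j + 1) * (P.mesh (j + 1))⁻¹ * t *
              (C₁ * Real.exp (-(1 / (4 * M) * (distC (underRegion (j + 1) sq₂) x / (P.L : ℝ) ^ (j + 1))))
                + C₂ * Real.exp (-(1 / (4 * M) * ρ))) := by
  obtain ⟨K₀min, h⟩ := eq267_deriv_higgs_region d L hd hL ha hmsq N C ε₀ creg β hcreg hβ
  refine ⟨K₀min, fun M hM => ?_⟩
  obtain ⟨e₁, he₁, C₁, C₂, hC₁, hC₂, h1⟩ := h M hM
  refine ⟨e₁, he₁, C₁, C₂, hC₁, hC₂, ?_⟩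
  intro P hPd hPL hPM j hk hsz hε bad rad hrad sq₂ sq₁ hs2 hs12 hs16 hsq A ec hec hle hreg x μ hx φ t ht hφ ρ hρ
  have hdvd : M ∣ P.M := hPM ▸ dvd_refl _
  have hΩ : IsBigBlockUnion (j + 1) M (underRegion (j + 1) (prime (towerRegion bad rad j 2))) :=
    hPM ▸ isBigBlockUnion_towerRegion_prime bad rad j 2
  exact h1 P hPd hPL hdvd (Nat.succ_le_succ (Nat.zero_le j)) hk hsz hε _ _ sq₂ sq₁
    (prime_towerRegion_six_subset_two bad hrad) hs2 hs12 hs16 hΩ hsq A hec hle hreg x μ hx φ t ht hφ ρ hρ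

/-- **(2.67), COVARIANT-DERIVATIVE FORM, AS PRINTED, FOR PRINT'S OWN REGIONS, `K₀ = M`**: `eq267_deriv_higgs_region_printed`
at `Λ₂ := Λ₂^{(j)′}`, `Λ₆ := Λ₆^{(j)′}`, `k = j + 1`, cube size `M` — `≤ C′·a_k·(Lᵏε)^κ` for every `κ`.
[cite: Balaban1982Higgs2, Lemma 2.4 proof (2.67) p.572 «and the same equality for the covariant derivative of φ^{(k)}»]
[cite: Balaban1982Higgs2, (2.55) p.570, (2.7)–(2.8) p.558] [cite: Balaban1982Higgs1, Prop. 2.1 p.610] -/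
theorem eq267_deriv_higgs_tower_printed (d L : ℕ) (hd : 1 ≤ d) (hL : 2 ≤ L) {a : ℝ} (ha : 0 < a) {msq : ℝ}
    (hmsq : 0 < msq) (N : ℕ) (C : ChargeData N) (ε₀ : ℝ) (creg β : ℝ) (hcreg : 0 ≤ creg) (hβ : 0 < β)
    (Q : B2.Params) (hQ : Q.Printed) {cl : ℝ} (hcl : 0 ≤ cl) (s κ : ℝ) :
    ∃ Mmin : ℕ, ∀ M : ℕ, Mmin ≤ M → ∃ e₁ : ℝ, 0 < e₁ ∧ ∃ C' : ℝ,
      ∀ (P : HiggsLattice.Params), P.d = d → P.L = L → P.M = M →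
      ∀ {j : ℕ}, j + 1 ≤ P.K → (∀ μ, 3 * half P (j + 1) M ≤ P.sitesPerDir 0 μ) → P.mesh (j + 1) ≤ ε₀ →
        P.mesh (j + 1) ≤ 1 →
      ∀ (bad : (l : ℕ) → Set (HiggsLattice.Site P l)) (rad : ℕ → ℝ), 0 ≤ rad j →
      ∀ (sq₂ sq₁ : Finset (HiggsLattice.Site P (j + 1))), sq₂ ⊆ prime (towerRegion bad rad j 2) → sq₁ ⊆ sq₂ →
        sq₁ ⊆ prime (towerRegion bad rad j 6) → IsBigBlockUnion (j + 1) M (underRegion (j + 1) sq₂) →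
      ∀ (A : HiggsLattice.VecField P 0) {ec : ℝ}, 0 < ec → ec ≤ e₁ →
      (∀ z ∈ underRegion (j + 1) (prime (towerRegion bad rad j 2)), ∀ μ ν : Fin P.d,
          P.mesh (j + 1) * |C.e| / ec * |A ⟨z.shift μ, ν⟩ - A ⟨z, ν⟩| ≤ creg * ec ^ (β - 1) / (P.L : ℝ) ^ (j + 1)) →
      ∀ (x : HiggsLattice.Site P 0) (μ : Fin P.d),
        (∀ z, HiggsLattice.Site.tdist x z ≤ 2 * rS P (j + 1) M + 2 * half P (j + 1) M * (P.d + 1) + 1 →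
          z ∈ underRegion (j + 1) sq₂) →
        (2 * B2.rFn Q.R Q.r (P.mesh (j + 1)) - s) * (P.L : ℝ) ^ (j + 1) ≤ distC (underRegion (j + 1) sq₂) x →
      ∀ (φ : HiggsLattice.ScalarField P (j + 1) N),
        (∀ y ∈ prime (towerRegion bad rad j 6),
          ‖φ y‖ ≤ cl * (P.mesh (j + 1) / Q.L) ^ (-(1 / 4 : ℝ)) * B2.pFn Q.b₀ Q.p (P.mesh (j + 1) / Q.L)) →
        (∀ y ∈ prime (towerRegion bad rad j 6), y ∉ sq₁ →
          2 * B2.rFn Q.R Q.r (P.mesh (j + 1)) - s ≤ (HiggsLattice.Site.tdist (blockIter (j + 1) x) y : ℝ)) →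
        ‖covDeriv C A (bgScalar256 C msq a (j + 1) (prime (towerRegion bad rad j 2)) (prime (towerRegion bad rad j 6)) A φ) ⟨x, μ⟩
            - covDeriv C A (bgScalar256 C msq a (j + 1) sq₂ sq₁ A φ) ⟨x, μ⟩‖
          ≤ C' * B1.aSeq a P.L (j + 1) * P.mesh (j + 1) ^ κ := by
  obtain ⟨K₀min, h⟩ := eq267_deriv_higgs_region_printed d L hd hL ha hmsq N C ε₀ creg β hcreg hβ Q hQ hcl s κ
  refine ⟨K₀min, fun M hM => ?_⟩
  obtain ⟨e₁, he₁, C', h1⟩ := h M hM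
  refine ⟨e₁, he₁, C', ?_⟩
  intro P hPd hPL hPM j hk hsz hε hℓ1 bad rad hrad sq₂ sq₁ hs2 hs12 hs16 hsq A ec hec hle hreg x μ hx hdist φ hφ hfar
  have hdvd : M ∣ P.M := hPM ▸ dvd_refl _
  have hΩ : IsBigBlockUnion (j + 1) M (underRegion (j + 1) (prime (towerRegion bad rad j 2))) :=
    hPM ▸ isBigBlockUnion_towerRegion_prime bad rad j 2
  exact h1 P hPd hPL hdvd (Nat.succ_le_succ (Nat.zero_le j)) hk hsz hε hℓ1 _ _ sq₂ sq₁
    (prime_towerRegion_six_subset_two bad hrad) hs2 hs12 hs16 hΩ hsq A hec hle hreg x μ hx hdist φ hφ hfar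

end

end Literature.MathematicalPhysics.QuantumFieldTheory.Balaban1983to89.B2Eq267HiggsRegion
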